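import Mathlib
import HarnessLib
import HarnessLib.Audit
import Summits.BirchSwinnertonDyer.Statement
import Summits.BirchSwinnertonDyer.BirchSwinnertonDyer.Theorems.Rank1ResidualX5TwoDefs
import Literature.NumberTheory.EllipticCurves.BSDSelmerPConverseYanZhuKolyvaginSystemProofs
import Literature.NumberTheory.EllipticCurves.BSDSelmerPConverse
import Literature.NumberTheory.EllipticCurves.NonvanishingTwistsBumpFriedbergHoffstein
import Literature.NumberTheory.EllipticCurves.BSDSelmerCMPConverseRankOneProofs
import Literature.NumberTheory.EllipticCurves.LeadingTerm
import Literature.NumberTheory.Automorphic.ShimuraCurveRibetTakahashiOptimalModularityProofs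
import Literature.NumberTheory.EllipticCurves.HeegnerPointsProofs
import Literature.NumberTheory.EllipticCurves.GrossLMS1991.HeegnerEulerSystemCongruenceImageFree
import HarnessLib.Audit.Status.Attr

/-!
Route: KolyvaginRankRigidityAtTwo

# Route KolyvaginRankRigidityAtTwo — Kolyvagin's conjecture and structure theorem at 2 give the
rank-one 2-converse

LINE 4 of ideator seat bsd-idea-1 (D-0145; closes rung S3 leaf `Rank1Residual.NonCMTwoConverse` —
the 2-CONVERSE corank_(ℤ₂) Sel_(2^∞)(E/ℚ) = r ⇒ ord_(s=1) L(E,s) = r for non-CM E with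
good-ordinary-or-multiplicative reduction at 2 — in its r = 1 branch; no summit is proved by this
line). It suffices to show X = V1 ∧ V2 (∧ the declared residual R ∧ two supports) on the habitat
«ρ_(E,2^∞) : G_ℚ → GL₂(ℤ₂) surjective»:
V1 (KolyvaginNonvanishingAtTwo) = Kolyvagin's conjecture AT p = 2: for K imaginary quadratic with
the Heegner hypothesis, d_K odd ≠ −3, 2 split, E(K)[2] = 0, some Heegner-point Kolyvagin class
c_M(n) ∈ H¹(K, E[2^M]) (n a squarefree product of Kolyvagin primes, 1 ≤ M ≤ M(n)) is non-zero;
V2 (KolyvaginCorankRigidityAtTwo) = Kolyvagin's 1991 structure theorem AT p = 2, read on ℤ₂-CORANKS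
only: at a non-zero class of minimal depth ν, either corank Sel_(2^∞)(E/ℚ) = ν + 1 and corank
Sel_(2^∞)(E^(d_K)/ℚ) ≤ ν, or the same with the roles exchanged;
R (OffHabitatTwoConverse) = the declared residual (r = 0, which is route TwoAdicConverse's, and r =
1 with non-surjective 2-adic image); supports: the printed inputs at 2 (2-parity, Hoffstein–Luo/BFH
Heegner field with 2 split, Kolyvagin–Kato finiteness for the rank-0 twist, Gross–Zagier over K,
Shimura reciprocity at conductor 1, modularity) and «E(K)[2] = 0 under surjective ρ̄_(E,2)».
Realises card kolyvagin-rank-rigidity-at-two.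
Lean: `KolyvaginNonvanishingAtTwo ∧ KolyvaginCorankRigidityAtTwo ∧ OffHabitatTwoConverse ∧
PrintedInputsRankOneAtTwo ∧ NoTwoTorsionOverK`

## Assembly
The deciding theorem `closes` (glue.lean, kernel-checked in Sketch4flat.lean rc 0) replays the
tree's p ≥ 5 assembly at p = 2: given W on the leaf with corank r ≤ 1, split on «r = 1 ∧ 2-adic
image surjective». Off it: OffHabitatTwoConverse. On it: 2-parity gives w(E) = −1;
`exists_heegnerField_split_twist_ne_zero_discr_emod_eight_of_hoffsteinLuo` (from the Modularity and
Hoffstein–Luo conjuncts of PrintedInputsRankOneAtTwo) gives K with (Heeg), 2 split, d_K ≡ 1 (mod 8)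
(so odd, ≠ −3, −4), L(E^(d_K),1) ≠ 0; Kolyvagin–Kato finiteness gives corank Sel_(2^∞)(E^(d_K)) = 0,
so c + c′ = 1; NoTwoTorsionOverK gives E(K)[2] = 0; V1 gives a non-zero class,
`heegnerSystem_exists_minimal_kolyvaginClass_ne_zero` one of minimal depth ν, V2 the dichotomy,
whence ν = 0 and n = 1 (omega + squarefree);
`heegnerSystem_analyticRankEK_eq_one_of_kolyvaginClass_one_ne_zero` (Gross–Zagier + reciprocity)
gives ord L(E/K) = 1; `analyticRankEK_eq_add_of` +
`analyticRank_eq_zero_of_entireLFunction_one_ne_zero` give ord L(E) = 1 = r.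

CLOSES_TARGET: closes rung S3 of BirchSwinnertonDyer: Summit.BirchSwinnertonDyer.BirchSwinnertonDyer.Rank1Residual.NonCMTwoConverse (D-0061; not the summit Statement) — the deciding theorem of this route concludes that registered leaf instead of the Statement decl `BirchSwinnertonDyer` (class rung: servable and labelled, never counted as concluding the summit Statement).

Rationale: WHY THIS LINE. Mechanism (rank axis, finite level, no Iwasawa theory, no p-adic height): the tree
already closes the rank-one p-converse for p ≥ 5 along BCGS Cor. 1 = Kolyvagin's conjecture (K1,
`BurungaleEtAl2026_exists_kolyvaginClass_ne_zero`, 3 < p) + Kolyvagin's structure theorem (K2,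
`Kolyvagin1991_selmerCorank_of_kolyvaginClass_ne_zero`, 5 ≤ p) + Gross–Zagier
(`burungaleEtAl2026_analyticRankEK_eq_one_of_selmerCorank_eq_one_of_kolyvaginSystem`,
`yanZhu_…_of_kolyvaginSystem`); this line PORTS exactly that assembly to p = 2 (glue `closes`
re-proves it at 2 from V1, V2: corank 1 over K ⇒ c + c′ = 1 ⇒ at the minimal non-zero class ν = 0 ⇒
the bottom class c_M(1) ≠ 0 ⇒ y_K non-torsion ⇒ ord L(E/K) = 1 ⇒ ord L(E) = 1), and asks the two
printed-for-odd-p theorems at p = 2 in the WEAKEST form the assembly consumes — existence of one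
non-zero class (V1) and the corank dichotomy without Kolyvagin's parity clauses (V2).
Rigidity/compactness lens of this seat: every 2-specific defect of Kolyvagin's method (non-split
±-eigenspaces of Gal(K/ℚ) on H¹(K, E[2^M]), the eigenvalue collision +1 ≡ −1 (mod 2) of complex
conjugation/Frobenius at Kolyvagin primes, E(K_n)[2], genus-theory 2-torsion in ring class groups,
Tamagawa/Manin 2-powers) is a BOUNDED 2-power error at each finite level, and ℤ₂-coranks do not see
bounded errors — V2 is stated on coranks precisely so that these defects die (Sources:
Kolyvagin1991MathAnn §2 Thm 4; WZhang2014 Thm 1.1/11.2 (p ≥ 5); arXiv:2312.09301 Thm 1 (p odd,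
[corpus:paper:arxiv-2312.09301 p.2–3]); arXiv:2203.12159 p.5 'the p ≥ 5 condition is required only
for the Chebotarev density type argument'; GrossLMS1991 §3–4 (p odd); McCallumLMS1991).
Imported from: Galois cohomology of elliptic curves (Kolyvagin/Euler systems), Heegner points on
X₀(N) and Gross–Zagier, 2-parity (DokchitserDokchitser2010), analytic non-vanishing of quadratic
twists (HoffsteinLuo1997 / BumpFriedbergHoffstein1990), 2-adic images (arXiv:1402.5997
Rouse–Zureick-Brown, DokchitserDokchitserMathZ2012 for the residual's shape). What it does that
listed routes do not: route TwoAdicConverse attacks ONLY r = 0 (cyclotomic/Eisenstein inputs at 2)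
and DECLARES r = 1 as its residual `RankOneTwoConverse`; every printed rank-one p-converse (Skinner,
W. Zhang, BCGS/Yan–Zhu, Burungale–Tian CM, Kim) needs p ≥ 5 or p odd, and the only p = 2 rank-one
converses in print are CM (Burungale–Tian, congruent numbers via Tian–Smith); no route and no tree
fact states Kolyvagin's conjecture or the structure theorem at 2. LINE 1 (GenusKolyvaginAtTwo) uses
the same Euler system on the FORMULA axis (McCallum exactness from a mod-2 PRIMITIVE class ⇒ #Ш);
here no primitivity, no exact formula and no Ш-order is needed — only non-vanishing at some 2-power
level and coranks.

RANKED CRUXES. #2 KolyvaginNonvanishingAtTwo (crux) — [V1, card K1 — Kolyvagin's conjecture at p =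
2] For non-CM E/ℚ (globally minimal W), good-ordinary or multiplicative at 2, with SURJECTIVE 2-adic
image (∀ m, ρ̄_(E,2^m) onto), and K imaginary quadratic with the Heegner hypothesis for N_E, d_K
odd, d_K ≠ −3, E(K)[2] = 0 and 2 split in K: there exist a modular parametrisation datum Dt,
orientation β, ι : K → ℂ, a squarefree product n of Kolyvagin primes (ℓ ∤ 2 N d_K inert, 2 | ℓ+1, 2
| a_ℓ: `Zhang2014.IsKolyvaginPrime … 2`), a Kolyvagin–Heegner datum d of conductor n and a level 1 ≤
M ≤ M(n) with c_M(n) = `d.kolyvaginClass Nat.prime_two M` ≠ 0 in H¹(K, E[2^M]). This is the tree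
fact K1 (BCGS Thm 1, `3 < p`) with p := 2 and the ordinarity clause widened to the leaf's (GoodOrd ∨
Mult). [difficulty: XL] (why it might fail: Printed proofs need p ≥ 5: W. Zhang's mod p^M level
raising (no admissible primes at 2; Chao Li's mod-2 rank-lowering obstruction at inert primes) and
BCGS's IMC+BDP road (Iwasawa theory at 2); Gross's classes assume p odd for the eigen-splitting at
Kolyvagin primes.) [WZhang2014, arXiv:2312.09301, Kolyvagin1991MathAnn, GrossLMS1991,
doi:10.1093/imrn/rnx188, arXiv:1501.01344, arXiv:0909.1069]
#3 KolyvaginCorankRigidityAtTwo (crux) — [V2, card K2 — Kolyvagin's structure theorem at p = 2, on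
coranks] Same curve habitat; K imaginary quadratic with d_K ≠ −3, −4, 2 ∤ d_K and the Heegner
hypothesis; for any datum (Dt, β, ι), any non-zero class c_M(n) ≠ 0 (n Kolyvagin-squarefree at 2, 1
≤ M ≤ M(n)) whose depth ν = #(prime factors of n) is MINIMAL among the non-zero classes of the
system: either corank_(ℤ₂) Sel_(2^∞)(E/ℚ) = ν + 1 ∧ corank_(ℤ₂) Sel_(2^∞)(E^(d_K)/ℚ) ≤ ν, or corank
Sel_(2^∞)(E^(d_K)/ℚ) = ν + 1 ∧ corank Sel_(2^∞)(E/ℚ) ≤ ν. This is the tree fact K2 (Kolyvagin 1991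
Thm 4 / W. Zhang Thm 11.2 (i), `5 ≤ p`, ρ̄_(E,p) onto, p ∤ N) with p := 2, 2-ADIC surjectivity in
place of mod-p surjectivity, (GoodOrd ∨ Mult at 2) in place of p ∤ N, and Kolyvagin's parity clauses
`Even (ν − c′)` dropped (the assembly does not use them). [deps: KolyvaginNonvanishingAtTwo]
[difficulty: L] (why it might fail: Kolyvagin 1991 Thm 4 assumes ℓ odd: the induction splits H¹(K,
E[ℓ^M]) and the local groups at Kolyvagin primes into ±-eigenspaces of τ and uses Cassels–Tate
alternation; at 2 the eigenvalues ±1 collide and each step loses 2-torsion — the bet: only bounded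
errors, invisible on coranks.) [Kolyvagin1991MathAnn, WZhang2014, McCallumLMS1991, GrossLMS1991,
arXiv:2203.12159, arXiv:2505.09121]
#4 OffHabitatTwoConverse (crux) — [R, residual — declared complement, not attacked by this line] The
leaf OFF the habitat: r = 0 (corank 0 ⇒ analytic rank 0: exactly route TwoAdicConverse's cruxes
GoodOrdinaryRankZeroTwoConverse / MultiplicativeRankZeroTwoConverse), and r = 1 for curves whose
2-adic image is NOT surjective (the 1207 non-maximal 2-adic images of Rouse–Zureick-Brown, incl.
every curve with a rational 2-torsion point or a rational 2-isogeny). Listed so that `closes` is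
honest; served to nobody by this route. [difficulty: open-problem] (why it might fail: It is an open
problem: r = 0 is TwoAdicConverse's territory (Iwasawa/Eisenstein inputs at 2), and r = 1 off the
surjective image needs a residually-reducible/small-image Kolyvagin argument at 2 that nobody has;
declared residual.) [arXiv:1402.5997, DokchitserDokchitserMathZ2012, arXiv:1405.7294,
arXiv:2006.11519]
#9 PrintedInputsRankOneAtTwo (support) — [S2, printed inputs at p = 2, all theorems in print]
Modularity (`ModularForms.exists_isNewformOf`, BCDT 2001) ∧ Hoffstein–Luo non-vanishing of quadratic
twists with prescribed local behaviour (`HoffsteinLuo1997_exists_twist_L_one_ne_zero`) ∧ 2-parity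
`p_parity V 2` for every elliptic V/ℚ (Dokchitser–Dokchitser 2010 Thm 1.4 with Monsky) ∧
`kato_finite_of_L_one_ne_zero V 2` (L(V,1) ≠ 0 ⇒ V(ℚ), Ш(V)[2^∞], Sel_(2^∞)(V) finite: Kolyvagin
1990 Thm A + Gross–Zagier + BFH/MM, p = 2 included since all of Ш is finite) ∧
`hasEntireLFunction_rat` ∧ Gross–Zagier over K in the form ord_(s=1) L(E/K,s) = 1 ↔ y_K non-torsion
(`analyticRankEK_eq_one_iff_heegner_nonTorsion`) ∧ Shimura reciprocity at conductor 1
(`heegnerPointOfConductor_one_galoisConj`). The glue consumes exactly these; none involves p-adic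
methods at 2. [difficulty: provable-now] [BCDT2001, HoffsteinLuo1997, DokchitserDokchitser2010,
Kolyvagin1989, GrossZagier1986, GrossLMS1991, Kato2004]
#9 NoTwoTorsionOverK (support) — [S3, (tor) at 2] If ρ̄_(E,2^m) is onto for all m (only m = 1 is
used: Gal(ℚ(E[2])/ℚ) ≅ GL₂(𝔽₂) ≅ S₃) and K is imaginary quadratic then E(K)[2] = 0: the 2-division
cubic is irreducible over ℚ with Galois group S₃, so its roots generate cubic fields, none of which
lies in the quadratic field K. (The tree lemma `torsionBy_eq_bot_of_isImaginaryQuadratic` has the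
hypothesis p ≠ 2; this is its p = 2 case, by the S₃ argument instead of the determinant argument.)
[difficulty: provable-now] [Serre1972, SilvermanAEC2009]

TWO-LAYER PLAN. Foreseen split of KolyvaginCorankRigidityAtTwo (birth skeleton
bc/KolyvaginCorankRigidityAtTwo_birth.lean): V2 ⇐ V2a → V2b → V2 with V2a = the SELMER BOUND at a
non-zero class of depth ν (corank Sel(E) ≤ ν+1, corank Sel(E^K) ≤ ν+1, and one of them ≤ ν:
Kolyvagin's Chebotarev–duality induction at 2, up to bounded index) and V2b = the LOWER bound (ν+1 ≤
corank of one side: the derivative classes strictly below the vanishing order are Selmer classes and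
give ν+1 independent elements mod 2^M for all large M); glue = omega. Foreseen split of
KolyvaginNonvanishingAtTwo (birth skeleton bc/KolyvaginNonvanishingAtTwo_birth.lean): the bottom
case «y_K non-torsion ⇒ c_M(1) ≠ 0 for large M» (Kummer injectivity, provable now) and the deep case
«y_K torsion (ord L(E/K) ≥ 3) ⇒ some c_M(n) ≠ 0», the latter to be attacked by W. Zhang's
rank-lowering induction with Le Hung–Li mod-2^M level raising and LINE 3's definite exactness at 2
(route DefiniteGrossPeriodAtTwo, crux GrossPeriodExactnessAtTwo) as the rank-0 base ('M_∞ finite ⟸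
BSD_2 unit for the level-raised rank-0 form').

KILL CRITERIA. Refutation of KolyvaginCorankRigidityAtTwo by ONE computed instance (a curve in the
habitat, a Heegner field K, a Kolyvagin prime ℓ at 2 and a certified non-zero class c_1(ℓ) of
minimal depth whose corank pattern violates the dichotomy — coranks from 2-adic descent/analytic
ranks under BSD-rank for the instance) closes the route `refuted:KolyvaginCorankRigidityAtTwo`
unless the violation is a parity-type correction (then restate with Kolyvagin's Even-clauses,
misstated class). A proof that Kolyvagin classes at 2 vanish identically for some habitat pair (E,
K) refutes KolyvaginNonvanishingAtTwo and closes the route. A proof elsewhere of the r = 1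
2-converse for non-CM curves with surjective 2-adic image (e.g. a 2-adic BDP main conjecture +
2-adic Waldspurger, arXiv:2304.09806-style, for non-CM curves) moots the line.

NOT DECOMPOSED YET. Kolyvagin's induction internals at 2 (the Chebotarev choice of Kolyvagin primes
with prescribed localisation when Frobenius = complex conjugation has the single eigenvalue 1 mod 2;
global duality / Cassels–Tate alternation for the 2^M-Selmer groups; the control of E(K_n)[2^∞] and
of the genus 2-part of Pic(O_n)), and the whole proof strategy of V1 (level raising mod 2^M vs.
2-adic anticyclotomic methods) are deliberately NOT items: layer-2 children after a prover claims
V1/V2 (D-0019).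

CHEAPEST FALSIFIER. INSTRUMENT ROW (decides an instance of V1, tests V2's dichotomy; = BC5 plan-only
rung `stub_rung_389a1_ell3`): E = 389a1 = [0,1,1,−2,0] (rank 2, N = 389, ρ̄_(E,2) ≅ S₃), K = ℚ(√−7)
(389 and 2 split, h_K = 1; w(E) = +1 forces rank E^(−7) odd), first Kolyvagin prime at 2: ℓ = 3
(inert, ℓ+1 = 4, a_3 = −2, M(3) = 1). Compute y_3 ∈ E(K[3]) ([K[3]:K] = 4) by complex CM points on
X₀(389) (Jetchev–Lauter–Stein, arXiv:0909.1069, who verified Kolyvagin's conjecture for 389a1 at p =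
3), form P_3 = Σ_σ σ(D_3 y_3), and decide P_3 ∈ 2E(K[3]) (⇔ c_1(3) = 0, as E(K[3])[2] = 0). V1∧V2
predict: c_M(1) = 0 (y_K torsion, ord L(E/K) = 3) and a non-zero class at depth exactly ν = 1 with
coranks (Sel(E), Sel(E^(−7))) = (2, ≤ 1); so some Kolyvagin ℓ gives c_1(ℓ) ≠ 0: ~20 Kolyvagin primes
all giving zero classes is strong evidence against V1 at 2; a non-zero c_1(ℓ) with 2-descent coranks
(2,1) CONFIRMS the pattern; a non-zero minimal class with coranks violating the dichotomy REFUTES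
V2. RUN 2026-08-28 (pen bsd-idea-1 g3; exact engine koly2j: the ℓ+1 conductor-ℓ Heegner points
summed at 2600 bits, the genus trace Y_L := Tr_{K[ℓ]/K(√ℓ*)} y_ℓ recognised over K and its
2-division decided exactly in E(L) — by the elementary identity D_ℓ y_ℓ ≡ Y_L (mod 2E(K[ℓ])) this
decides c₁(ℓ); re-audited with an exact period-lattice test after an artefact (Y_L = O mis-read as x
= 0) was found and removed; memo koly2j/KOLY2-RESULT-v4.md on 24622/23948): THE INSTRUMENT ROW IS
DECIDED POSITIVELY — 389a1/ℚ(√−7), ℓ = 3: x(Y_L) = −131/84, Y_L non-torsion, Y_L ∉ 2E(L), hence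
c₁(3) ≠ 0 (a non-zero class at depth ν = 1, as V1 ∧ V2 predict; ranks (E, E^(−7)) = (2, 1) with Ш_an
= 1 on both, so the coranks are (2, 1)). Wider table (17 rank-2 curves, 52 classes; every ℓ a
`Zhang2014.IsKolyvaginPrime … 2 ℓ` prime, 'one-root' = the 2-division cubic has exactly one root mod
ℓ): on the 8 curves with ∏c = 1 a 2-primitive genus trace (c₁(ℓ) ≠ 0, M = 1 witness of V1′) occurs
at a one-root Kolyvagin prime ℓ ≤ 53 on 8/8 (13/16 of the non-degenerate one-root classes; 0/6 at
primes where the cubic splits completely); on the 9 curves with an even Tamagawa number every one of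
22 computed mod-2 classes vanishes — Y_L = O exactly when the genus-twist pair (E^{ℓ*}, E^{Dℓ*}) has
analytic ranks (1,2)/(2,1) (Gross–Zagier; 12/12 rows predicted), Y_L ∈ 2E(L) ∖ {O} otherwise — and
on 718b1 (c₂ = 2, I₄) the class REAPPEARS mod 4: c₂(47) ≠ 0 (M_47 = 4; W := Z₁ − Z₃ + 2Z₂ ∈ 2E(L) ∖
4E(L), W-test j299973; lattice-instrumented confirmation re-run j301892 pending at this revision),
the first M = 2 witness of V1′. Reading for provers: V1′ witnesses exist at (ℓ, M = 1) for
Tamagawa-trivial pairs and at M ≥ 2 where an even c_q pushes the genus-twist Heegner index up by 2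
(Jetchev-type divisibility on the twist pair); primes at which the 2-division cubic splits
completely gave c₁ = 0 in 6/6 cases and should be skipped.

NUMBERS. Printed thresholds: Kolyvagin's conjecture proved for p ≥ 5, ρ̄ onto, ramification
hypotheses (WZhang2014 Thm 1.1; [corpus:paper:doi-10-4171-owr-2023-28 p.27 'p ≠ 2, 3']); for p odd
good ordinary split in K + (irr)/(p > 3) (BCGS Thm 1, [corpus:paper:arxiv-2312.09301 p.3 L130–142]);
structure theorem: ℓ odd in B(E) (Kolyvagin1991MathAnn §1), restated for p ≥ 5 (WZhang2014 Thm
11.2); Kolyvagin-system Chebotarev arguments: 'the p ≥ 5 condition is required only for the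
Chebotarev density type argument in [mazur-rubin-book]' [corpus:paper:arxiv-2203.12159 p.5 L65], 'In
[mazur-rubin-book], the condition p > 3 is used only in the refined Chebotarev density result'
[corpus:paper:arxiv-2505.09121 p.11 L100]. Residue attacked: LADDER-BSD rung S3 (rank axis at 2),
the r = 1 half that route TwoAdicConverse declares residual; habitat = surjective 2-adic image
(generic: all but the 1207 RZB images, arXiv:1402.5997).

DEFINITION REQUESTS. None: `KolyvaginHeegnerData`, `kolyvaginClass`, `KolyvaginDescent.KolSupp`,
`Zhang2014.IsKolyvaginPrime`, `Zhang2014.levelIndex`, `ModularForms.ModularParametrizationData`,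
`selmerCorank`, `quadraticTwist`, `HasSurjectiveModNGaloisRep`, `IsImaginaryQuadratic`,
`SatisfiesHeegnerHypothesis`, `analyticRankEK` all exist (resolved with lean check 2026-08-28,
bc/resolve4.lean).

Novelty: Searches (2026-08-28): lit search --hybrid "Kolyvagin conjecture non-vanishing Heegner point
Kolyvagin system p = 2" (8 docs: li2025 BSD rational curves p.19, delbourgo2008, arXiv:2407.11891,
arXiv:1210.8231 Tian congruent numbers — none states Kolyvagin's conjecture at 2 for non-CM curves);
lit vsearch "Kolyvagin's structure theorem … at the prime 2" (8 generic book hits: coates1999 p.234,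
editornd-l-functions-arithmetic p.277 = McCallum, burns2007); lit search "p-converse rank one p = 2
elliptic curves Kolyvagin" --source all (local 10: arXiv:2304.09806 p-adic Waldspurger non-split,
arXiv:2211.04907, li2025, arXiv:2203.12159 Kim, arXiv:2109.12344 soft p-converse,
doi:10.1007/s40316-022-00203-y CM p>3, arXiv:2104.06732 congruent numbers, arXiv:2505.09121,
doi:10.1017/s147474802300021x CM; remote crossref 10 incl. doi:10.4007/annals.2026.203.1.1
Burungale–Tian rank-zero CM); lit read arXiv:2312.09301 / 2211.04907 / 2505.09121 / 2203.12159
--grep 'p > 3|p ≥ 5|odd prime|p = 2' (every theorem p odd / p ≥ 5, quoted under Numbers); lit galaxy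
search --star all "Kolyvagin's conjecture" (0), "Kolyvagin conjecture|Kolyvagin system" (12 rows:
LMS lecture-note volumes, Morishita — no p = 2 statement), "2-converse|2-adic converse" and
"structure of Selmer groups" (see lit_line4.txt); lean search / rg: K1, K2 and the BCGS/Yan–Zhu
assembly exist in the tree ONLY with `3 < p` / `5 ≤ p`; `rg selmerCorank 2 = 1` in Theses:
TwoAdicConverse.RankOneTwoConverse is a declared RESIDUAL, attacked b  [refs: 10.1007/s40316-022-00203-y, 10.1017/s147474802300021x, 10.4007/annals.2026.203.1.1, 2407.11891, 1210.8231, 2304.09806, 2211.04907, 2203.12159, 2109.12344, 2104.06732, 2505.09121, 2312.09301, doi:10.1007/s40316-022-00203-y, doi:10.1017/s147474802300021x, doi:10.4007/annals.2026.203.1.1, WZhang2014]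

Barriers (technique_class: kolyvagin-system, heegner-points, rigidity, galois-cohomology): - technique_class: kolyvagin-system, heegner-points, rigidity, galois-cohomology
- Literature.Barriers.BirchSwinnertonDyer.HeegnerPointBarrier: consistent, not evaded — the line
lives in rank r = 1 where y_K IS non-torsion at the end of the argument; the barrier (Heegner points
torsion in analytic rank ≥ 2) is exactly why V1 is non-trivial for rank-2 curves like 389a1 (classes
of depth ≥ 1 carry the information) and why the leaf is restricted to r ≤ 1.
- Literature.Barriers.BirchSwinnertonDyer.HeegnerPointBarrierNarrow: consistent, and its recorded
evasion (i) IS the line — the barrier blocks K-rational Heegner points as point supply when 2 ≤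
analyticRank; this route concludes analyticRank = 1 only (leaf r ≤ 1, r = 0 residual), and its
cruxes live on the DERIVED classes c_M(n) ('the derived part of the Euler system sees every rank at
the Selmer level: κ^∞ ≠ 0', WZhang2014 Thm 1.1 = the barrier's evasions_known (i)), asked at p = 2.
- Literature.Barriers.BirchSwinnertonDyer.EulerSystemBigImageBarrier: outside — the habitat demands
SURJECTIVE 2-adic image (all ρ̄_(E,2^m) onto), the analogue of Kolyvagin's ℓ ∈ B(E); the barrier
quantifies over irreducible non-surjective images, which are in the declared residual R.
- Literature.Barriers.BirchSwinnertonDyer.SignedIwasawaTheoryAtTwoBarrier: outside — no cyclotomic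
or anticyclotomic tower, no p-adic L-function, no signed Coleman map: V1/V2 are finite-level
Galois-cohomology statements over K and its ring class fields (this is the p

History (route lifecycle, newest last):
- 2026-08-28T15:01:20Z · rev 29: informal re-worded for FullClassDeepeningAtTwo (planner-bsd-idea-1-g7-0)
- 2026-08-28T15:03:33Z · rev 29: informal re-worded for FullClassDeepeningAtTwo (planner-bsd-idea-1-g7-0)

sub-problem: BirchSwinnertonDyer · status: open · opened planner-bsd-idea-1-g2-0 2026-08-28T00:04:37Z · rev 31 · ledger route-BirchSwinnertonDyer-KolyvaginRankRigidityAtTwo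
GENERATED by the gate from the ledger (D-0016/17). Provers cite these decls: `theorem foo : Summit.BirchSwinnertonDyer.BirchSwinnertonDyer.Theses.KolyvaginRankRigidityAtTwo.<Decl> := …` in Summits/BirchSwinnertonDyer/BirchSwinnertonDyer/Theorems/<Name>.lean.
-/

namespace Summit.BirchSwinnertonDyer.BirchSwinnertonDyer.Theses.KolyvaginRankRigidityAtTwo

open scoped BigOperators Topology Manifold Classical MeasureTheory ProbabilityTheory Matrix InnerProductSpace ComplexConjugate ContinuousMap
open Filter Set Function TopologicalSpace MeasureTheory

attribute [summit_statement] _root_.BirchSwinnertonDyer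
attribute [summit_statement] _root_.Summit.BirchSwinnertonDyer.BirchSwinnertonDyer.Rank1Residual.NonCMTwoConverse

open Literature

/-- item stmt-BirchSwinnertonDyer-27983 · crux · rank 2 · SPLIT (gen 1) into KolyvaginBoundedDefectAtTwo, FullClassDeepeningAtTwo + glue StrongNonzeroSystemOfSeedTransport · direct attempts still welcome (low priority) · by planner
why it might fail: Kolyvagin's conjecture at 2 in STRONG form (depth fixed before the margin): Zhang 2014/Sweeting need p ≥ 5 or 3 and a level-raised rank-0 anchor absent at 2; KOLY2 v4 saw all mod-2 classes vanish on even-Tamagawa curves, so a parity obstruction at every depth for some frame would refute it.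
sources: Kolyvagin1991MathAnn, WZhang2014, GrossLMS1991, McCallumLMS1991
[crux · V1′∞ · Kolyvagin's STRONG NON-ZERO SYSTEM at 2] On the habitat (E/ℚ non-CM, good-ordinary or
multiplicative at 2, ρ_{E,2^∞} surjective; K Heegner for N with d_K odd, d_K ≠ −3, E(K)[2] = 0, 2
split in K; any modular parametrisation datum Dt, β with 4N ∣ β² − d_K): there is a depth r such
that for EVERY θ, k there is a non-zero Kolyvagin class c_M(n) ∈ H¹(K, E[2^M]) with n
Kolyvagin-squarefree of exactly r prime factors, 1 ≤ M and θ·M + k ≤ M(n) (the level index).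
Kolyvagin, Math. Ann. 291 (1991) p. 259, (2.1)/Conj. 2.5 verbatim in relative-margin currency at ℓ =
2. Implies V1′θ 27219 (`RichTurnkey.theta_of_strongSystem`, rc0). In analytic rank one over K, r = 0
(n = 1, y_K non-torsion) — the content is the torsion-y_K frames. -/
@[route_item "route-BirchSwinnertonDyer-KolyvaginRankRigidityAtTwo", crux]
def KolyvaginStrongNonzeroSystemAtTwo : Prop :=
  ∀ (W : WeierstrassCurve ℚ) [W.IsElliptic] [W.IsGloballyMinimal], ¬ W.HasCM → (Literature.NumberTheory.EllipticCurves.Rank1Residual.GoodOrd W 2 ∨ Literature.NumberTheory.EllipticCurves.Rank1Residual.Mult W 2) → (∀ m : ℕ, W.HasSurjectiveModNGaloisRep (2 ^ m : ℕ)) → ∀ (K : Type) [Field K] [NumberField K], Literature.NumberTheory.EllipticCurves.IsImaginaryQuadratic K → ∀ [NeZero (W.conductorNorm ℤ)], Literature.NumberTheory.EllipticCurves.SatisfiesHeegnerHypothesis (W.conductorNorm ℤ) K → Odd (NumberField.discr K) → NumberField.discr K ≠ -3 → AddSubgroup.torsionBy (W.baseChange K).toAffine.Point (2 : ℤ) =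 ⊥ → Literature.NumberTheory.EllipticCurves.SatisfiesHeegnerHypothesis 2 K → ∀ (Dt : Literature.NumberTheory.EllipticCurves.ModularForms.ModularParametrizationData W (W.conductorNorm ℤ)) (β : ℤ) (ι : K →+* ℂ), (4 * (W.conductorNorm ℤ : ℤ)) ∣ β ^ 2 - NumberField.discr K → ∃ r : ℕ, ∀ θ k : ℕ, ∃ (n : ℕ) (d : Literature.NumberTheory.EllipticCurves.KolyvaginHeegnerData Dt β ι n) (M : ℕ), Literature.NumberTheory.EllipticCurves.KolyvaginDescent.KolSupp (Literature.NumberTheory.EllipticCurves.Zhang2014.IsKolyvaginPrime (W.conductorNorm ℤ) W K 2) n ∧ n.primeFactors.card = r ∧ 1 ≤ M ∧ ((θ * M + k : ℕ) : ℕ∞) ≤ Literature.NumberTheory.EllipticCurves.Zhang2014.levelIndex W 2 n ∧ d.kolyvaginClass Nat.prime_two M ≠ 0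

-- parent: KolyvaginStrongNonzeroSystemAtTwo · child (gen 1)
/--     item stmt-BirchSwinnertonDyer-28083 · crux · rank 201 · open
    parent: KolyvaginStrongNonzeroSystemAtTwo · by planner
    why it might fail: Kolyvagin's Conjecture A at p = 2 in exponent form: W. Zhang's induction needs BD-admissible level-raising primes, absent at 2; Kolyvagin's propagation m_r ≥ m_{r+1} starts from a class possibly too thin relative to its level for an informative swap — no printed engine gives a uniform defect bound.
    sources: Kolyvagin1991MathAnn, WZhang2014, McCallumLMS1991, GrossLMS1991
[crux · LINE 14 child U1 = SEED / existence half of V1′∞ 27983, Kolyvagin's own exponent currency]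
On the universal frame of V1′∞ (non-CM E/ℚ, good-ordinary-or-multiplicative at 2, ρ_{E,2^m} onto ∀m,
K imaginary quadratic Heegner for N with odd d_K ≠ −3, E(K)[2] = 0, 2 split in K; every (Dt, β, ι)
with 4N ∣ β² − d_K): there are a depth r and a defect bound m such that at EVERY level M > m some
Kolyvagin conductor n of depth r with M ≤ M(n) carries a class c_M(n) of order ≥ 2^(M−m), i.e.
2^(M−m−1)·c_M(n) ≠ 0 — Kolyvagin's «m_r < ∞, attained at arbitrarily deep n» (Math. Ann. 291 (1991)
§2; at p ≥ 5 W. Zhang CJM 2014 Thm 1.1 gives the shape with m = 0). Implies the asided V1′ 24622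
(take M = m+1). r = 0 is the regime y_K non-torsion (m = 2-divisibility exponent of y_K, Kummer
injectivity as E(K)[2^∞] = 0, M(1) = ∞): a first rung, not the content. Fullness (bounded defect),
not bare non-vanishing, is what survives lossy prime transport at 2 (SWAP-LEDGER of crux 27220, LEAD
krr2-p1 g6/g7) — hence this currency. No summit / rung / crux is proved by filing this. -/
@[route_item "route-BirchSwinnertonDyer-KolyvaginRankRigidityAtTwo", crux]
def KolyvaginBoundedDefectAtTwo : Prop :=
  ∀ (W : WeierstrassCurve ℚ) [W.IsElliptic] [W.IsGloballyMinimal], ¬ W.HasCM → (Literature.NumberTheory.EllipticCurves.Rank1Residual.GoodOrd W 2 ∨ Literature.NumberTheory.EllipticCurves.Rank1Residual.Mult W 2) → (∀ m : ℕ, W.HasSurjectiveModNGaloisRep (2 ^ m : ℕ)) → ∀ (K : Type) [Field K] [NumberField K], Literature.NumberTheory.EllipticCurves.IsImaginaryQuadratic K → ∀ [NeZero (W.conductorNorm ℤ)], Literature.NumberTheory.EllipticCurves.SatisfiesHeegnerHypothesis (W.conductorNorm ℤ) K → Odd (NumberField.discr K) → NumberField.discr K ≠ -3 → AddSubgroup.torsionBy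 (W.baseChange K).toAffine.Point (2 : ℤ) = ⊥ → Literature.NumberTheory.EllipticCurves.SatisfiesHeegnerHypothesis 2 K → ∀ (Dt : Literature.NumberTheory.EllipticCurves.ModularForms.ModularParametrizationData W (W.conductorNorm ℤ)) (β : ℤ) (ι : K →+* ℂ), (4 * (W.conductorNorm ℤ : ℤ)) ∣ β ^ 2 - NumberField.discr K → ∃ r m : ℕ, ∀ M : ℕ, m < M → ∃ (n : ℕ) (d : Literature.NumberTheory.EllipticCurves.KolyvaginHeegnerData Dt β ι n), Literature.NumberTheory.EllipticCurves.KolyvaginDescent.KolSupp (Literature.NumberTheory.EllipticCurves.Zhang2014.IsKolyvaginPrime (W.conductorNorm ℤ) W K 2) n ∧ n.primeFactors.card = r ∧ ((M : ℕ) : ℕ∞) ≤ Literature.NumberTheory.EllipticCurves.Zhang2014.levelIndex W 2 n ∧ (2 ^ (M - m - 1) : ℤ) • d.kolyvaginClass Nat.prime_two M ≠ 0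

-- parent: KolyvaginStrongNonzeroSystemAtTwo · child (gen 1)
/--     item stmt-BirchSwinnertonDyer-28084 · crux · rank 202 · open
    parent: KolyvaginStrongNonzeroSystemAtTwo · by planner
    why it might fail: The per-swap loss c₂ must be UNIFORM in M and the primes; at 2 the error terms (H¹(K(E[2^M])/K,E[2^M]), ± eigen-defect, Sah bit) are O(1) each, but an informative Čebotarev prime must ALSO meet the index bound M(ℓ′) ≥ θM′+k, and the two Frobenius conditions may clash in Gal(K(E[2^{M″}])/ℚ), θ ≥ 2.
    sources: Kolyvagin1991MathAnn, McCallumLMS1991, GrossLMS1991, WZhang2014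
[crux · LINE 14 child U2 = TRANSPORT HALF of V1′∞ — STATUS 2026-08-28T14:46Z: LANDED MODULO ONE
PRINT FACT] `FullClassDeepeningAtTwo`: on V1′∞'s habitat and frame there is c : ℕ such that every
non-CM Kolyvagin class c_M(n) at 2 of depth r at a deep level M ≤ M(n) with BOUNDED DEFECT
(2^(M−m−1)·c_M(n) ≠ 0, i.e. ord ≥ 2^(M−m)) and c·(m+r+1) ≤ M transports to a NON-ZERO class
c_{M′}(n′) ≠ 0 of the same depth r at every prescribed index margin θ·M′ + k ≤ M(n′), 1 ≤ M′ (the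
seed-phase lossy prime swaps of the LEAD's walk, stated as an item). PROVED modulo Gross 1991 Prop.
3.7 (2) ONLY:
`Summit.BirchSwinnertonDyer.BirchSwinnertonDyer.Theorems.KolyvaginLowerBoundAtTwo.fullClassDeepeningAtTwo_of_prop37
(h37 : GrossLMS1991.prop37_2_frobeniusCongruence) : FullClassDeepeningAtTwo` (LEAD krr2-p1 g8,
p642176: one level down `globalOrderLevelDownAtTwo` + Čebotarev S2 + seed walk
`seedTransport_of_lossySwap` on S1L `primeSwapAtTwoLossy_of_namedFacts`; c = c₀+2c₁+2c₂+4, M′ =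
M−1). The print fact is the shared route item stmt-BirchSwinnertonDyer-23091
`Prop37FrobeniusCongruenceAtTwo` (child of V2♭∞ 27984 since rev 28; wanted by 5 routes; XL typing
job: Eichler–Shimura mod ℓ through the modular par -/
@[route_item "route-BirchSwinnertonDyer-KolyvaginRankRigidityAtTwo"]
def FullClassDeepeningAtTwo : Prop :=
  ∀ (W : WeierstrassCurve ℚ) [W.IsElliptic] [W.IsGloballyMinimal], ¬ W.HasCM → (Literature.NumberTheory.EllipticCurves.Rank1Residual.GoodOrd W 2 ∨ Literature.NumberTheory.EllipticCurves.Rank1Residual.Mult W 2) → (∀ m : ℕ, W.HasSurjectiveModNGaloisRep (2 ^ m : ℕ)) → ∀ (K : Type) [Field K] [NumberField K], Literature.NumberTheory.EllipticCurves.IsImaginaryQuadratic K → ∀ [NeZero (W.conductorNorm ℤ)], Literature.NumberTheory.EllipticCurves.SatisfiesHeegnerHypothesis (W.conductorNorm ℤ) K → Odd (NumberField.discr K) → NumberField.discr K ≠ -3 → AddSubgroup.torsionBy (W.baseChange K).toAffine.Point (2 : ℤ) = ⊥ → Literature.NumberTheory.EllipticCurves.SatisfiesHeegnerHypothesis 2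 K → ∀ (Dt : Literature.NumberTheory.EllipticCurves.ModularForms.ModularParametrizationData W (W.conductorNorm ℤ)) (β : ℤ) (ι : K →+* ℂ), (4 * (W.conductorNorm ℤ : ℤ)) ∣ β ^ 2 - NumberField.discr K → ∃ c : ℕ, ∀ (θ k r m M n : ℕ) (d : Literature.NumberTheory.EllipticCurves.KolyvaginHeegnerData Dt β ι n), Literature.NumberTheory.EllipticCurves.KolyvaginDescent.KolSupp (Literature.NumberTheory.EllipticCurves.Zhang2014.IsKolyvaginPrime (W.conductorNorm ℤ) W K 2) n → n.primeFactors.card = r → ((M : ℕ) : ℕ∞) ≤ Literature.NumberTheory.EllipticCurves.Zhang2014.levelIndex W 2 n → c * (m + r + 1) ≤ M → (2 ^ (M - m - 1) : ℤ) • d.kolyvaginClass Nat.prime_two M ≠ 0 → ∃ (n' : ℕ) (d' : Literature.NumberTheory.EllipticCurves.KolyvaginHeegnerData Dt β ι n') (M' : ℕ), Literature.NumberTheory.EllipticCurves.KolyvaginDescent.KolSupp (Literature.NumberTheory.EllipticCurves.Zhang2014.IsKolyvaginPrime (W.conductorNorm ℤ) W K 2) n' ∧ n'.primeFactors.card = r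 ∧ 1 ≤ M' ∧ ((θ * M' + k : ℕ) : ℕ∞) ≤ Literature.NumberTheory.EllipticCurves.Zhang2014.levelIndex W 2 n' ∧ d'.kolyvaginClass Nat.prime_two M' ≠ 0

-- parent: KolyvaginStrongNonzeroSystemAtTwo · glue (gen 1)
/--     item stmt-BirchSwinnertonDyer-28085 · support · rank 203 · closed · proved by Summit.BirchSwinnertonDyer.BirchSwinnertonDyer.Theorems.KolyvaginRigidity.strongNonzeroSystemOfSeedTransport_proof (planner)
    parent: KolyvaginStrongNonzeroSystemAtTwo · GLUE: children ⟹ parent · by planner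
LINE 14 glue: KolyvaginBoundedDefectAtTwo → FullClassDeepeningAtTwo →
KolyvaginStrongNonzeroSystemAtTwo — given the frame take c from U2 and (r, m) from U1, set M :=
c·(m+r+1)+m+1 > m, take U1's nearly-full class at level M and transport it with U2 (kernel-checked
in folder line14/probe14.lean `strongSystem_of_seed_transport`, rc0); the pen proves the glue item
the hour it exists. -/
@[route_item "route-BirchSwinnertonDyer-KolyvaginRankRigidityAtTwo"]
def StrongNonzeroSystemOfSeedTransport : Prop :=
  KolyvaginBoundedDefectAtTwo → FullClassDeepeningAtTwo → KolyvaginStrongNonzeroSystemAtTwo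

-- `StrongNonzeroSystemOfSeedTransport` holds: proved by `Summit.BirchSwinnertonDyer.BirchSwinnertonDyer.Theorems.KolyvaginRigidity.strongNonzeroSystemOfSeedTransport_proof` (its module imports this route file, so no `_holds` link can be stated here).

/-- item stmt-BirchSwinnertonDyer-27984 · crux · rank 3 · SPLIT (gen 1) into Prop37FrobeniusCongruenceAtTwo, CorankLowerBoundAtTwoRichOfProp37 + glue CorankLowerBoundAtTwoRichOfPrintSplit · direct attempts still welcome (low priority) · by planner
why it might fail: Fails only if the lossy swap's per-step loss c₂ is not uniform in ν (seed-phase Sah/type bits unbounded; SWAP-LEDGER §2 bounds them by 3) or Gross 1991 Prop 3.7(2) / Poitou–Tate for the mod-2^M Selmer structure is mis-typed at p = 2 (local conditions at 2, ∞ not self-dual).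
sources: Kolyvagin1991MathAnn, McCallumLMS1991, GrossLMS1991, Howard2004, WZhang2014
[crux · V2♭∞ · corank lower bound from a RICH seed] On V2♭'s habitat, for every frame (K, Dt, β, ι)
and depth ν: if depth ν is RICH (for every θ, k some non-zero (θ,k)-strong class of depth exactly ν)
and every smaller depth ν′ < ν is not (some (θ, k) with all (θ,k)-strong classes of depth ν′ zero),
then ν + 1 ≤ corank Sel_{2^∞}(E/ℚ) or ν + 1 ≤ corank Sel_{2^∞}(E^{(d_K)}/ℚ). Kolyvagin's structure
theorem (Math. Ann. 291 Thm 2.2 / McCallum 1991 Thm 5.2) at ℓ = 2 in the form the LOSSY prime swap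
proves: `windowsRich_of_lossySwap` (p622030) + S1-lossy/S2/S3/S4/T1; LEAD krr2-p1 g8 reports it
closed modulo GrossLMS1991 Prop 3.7(2) and Poitou–Tate duality for finite Selmer structures (files
SwapHybridFrameNine / SwapOfNamedFacts / RichOfNamedFacts). -/
@[route_item "route-BirchSwinnertonDyer-KolyvaginRankRigidityAtTwo", crux]
def KolyvaginCorankLowerBoundAtTwoRich : Prop :=
  ∀ (W : WeierstrassCurve ℚ) [W.IsElliptic] [W.IsGloballyMinimal], ¬ W.HasCM → (Literature.NumberTheory.EllipticCurves.Rank1Residual.GoodOrd W 2 ∨ Literature.NumberTheory.EllipticCurves.Rank1Residual.Mult W 2) → (∀ m : ℕ, W.HasSurjectiveModNGaloisRep (2 ^ m : ℕ)) → ∀ (K : Type) [Field K] [NumberField K], Literature.NumberTheory.EllipticCurves.IsImaginaryQuadratic K → NumberField.discr K ≠ -3 → NumberField.discr K ≠ -4 → ¬ ((2 : ℤ) ∣ NumberField.discr K) → ∀ [NeZero (W.conductorNorm ℤ)], Literature.NumberTheory.EllipticCurves.SatisfiesHeegnerHypothesis (W.conductorNorm ℤ) K → ∀ (Dt : Literature.NumberTheory.EllipticCurves.ModularForms.ModularParametrizationData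 W (W.conductorNorm ℤ)) (β : ℤ) (ι : K →+* ℂ) (ν : ℕ), (∀ θ k : ℕ, ∃ (n : ℕ) (d : Literature.NumberTheory.EllipticCurves.KolyvaginHeegnerData Dt β ι n) (M : ℕ), Literature.NumberTheory.EllipticCurves.KolyvaginDescent.KolSupp (Literature.NumberTheory.EllipticCurves.Zhang2014.IsKolyvaginPrime (W.conductorNorm ℤ) W K 2) n ∧ n.primeFactors.card = ν ∧ 1 ≤ M ∧ ((θ * M + k : ℕ) : ℕ∞) ≤ Literature.NumberTheory.EllipticCurves.Zhang2014.levelIndex W 2 n ∧ d.kolyvaginClass Nat.prime_two M ≠ 0) → (∀ ν' : ℕ, ν' < ν → ∃ θ k : ℕ, ∀ (n' : ℕ) (d' : Literature.NumberTheory.EllipticCurves.KolyvaginHeegnerData Dt β ι n') (M' : ℕ), Literature.NumberTheory.EllipticCurves.KolyvaginDescent.KolSupp (Literature.NumberTheory.EllipticCurves.Zhang2014.IsKolyvaginPrime (W.conductorNorm ℤ) W K 2) n' → 1 ≤ M' → ((θ * M' + k : ℕ) : ℕ∞) ≤ Literature.NumberTheory.EllipticCurves.Zhang2014.levelIndex W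 2 n' → n'.primeFactors.card = ν' → d'.kolyvaginClass Nat.prime_two M' = 0) → (ν + 1 ≤ W.selmerCorank 2 ∨ ν + 1 ≤ (W.quadraticTwist (NumberField.discr K : ℚ)).selmerCorank 2)

-- parent: KolyvaginCorankLowerBoundAtTwoRich · child (gen 1)
/--     item stmt-BirchSwinnertonDyer-23091 · support · rank 301 · open
    parent: KolyvaginCorankLowerBoundAtTwoRich · by planner
    why it might fail: A published theorem (Gross 1991 Prop 3.7(2); Nekovář 2007 Prop 4.9); the only risk is a typing mismatch between the Literature decl's valuation-subring phrasing of 'mod λ_n' and the printed congruence, to be settled when Eichler–Shimura mod ℓ is typed.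
    sources: GrossLMS1991, Nekovar2007, Kolyvagin1991MathAnn
[aside, cite-only] Gross 1991 Prop. 3.7 (2) (Nekovář 2007 Prop. 4.9/4.13(ii)): the Frobenius
congruence y_n ≡ Frob_ℓ y_m (mod λ_n) of the Heegner Euler system, image-free named fact (PUBLISHED;
no mod-p image or CM hypothesis). Print head (γ) of p4's stub_jetchevX9 chain. [cite: GrossLMS1991,
Prop. 3.7 (2) p. 240] [cite: Nekovar2007, Prop. 4.9, 4.13 (ii)] — conjunct 1 of JetchevPrintFactsX9
— filed so the cite_only head constant is item-stated BY NAME (gate5 #15c one rule; staffable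
remedy); banked context (D-0019 aside): never staffed, not progress, closes only when the named fact
becomes a theorem. -/
@[route_item "route-BirchSwinnertonDyer-KolyvaginRankRigidityAtTwo"]
def Prop37FrobeniusCongruenceAtTwo : Prop :=
  Literature.NumberTheory.EllipticCurves.GrossLMS1991.prop37_2_frobeniusCongruence

-- parent: KolyvaginCorankLowerBoundAtTwoRich · child (gen 1)
/--     item stmt-BirchSwinnertonDyer-28229 · support · rank 302 · closed · proved by Summit.BirchSwinnertonDyer.BirchSwinnertonDyer.Theorems.KolyvaginRigidity.corankLowerBoundAtTwoRichOfProp37_proof (planner)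
    parent: KolyvaginCorankLowerBoundAtTwoRich · by planner
    why it might fail: Cannot fail mathematically — the implication is the accepted kernel theorem p641767; only a definitional-unfolding hiccup between the child `Prop37FrobeniusCongruenceAtTwo` and the Literature decl could delay the one-line by-name proof.
    sources: GrossLMS1991, Kolyvagin1991MathAnn, McCallumLMS1991, Howard2004
[support · KERNEL HALF, provable NOW by name] Gross 3.7(2) ⇒ V2♭∞
`KolyvaginCorankLowerBoundAtTwoRich` (stmt-27984): exactly the ACCEPTED theorem
`Summit.BirchSwinnertonDyer.BirchSwinnertonDyer.Theorems.KolyvaginLowerBoundAtTwo.KolyvaginCorankLowerBoundAtTwoRich_of_prop37`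
(LEAD krr2-p1 g8, p641767: lossy prime swap S1L `primeSwapAtTwoLossy_of_namedFacts` from Prop 3.7(2)
alone, Poitou–Tate = tree theorem
`InputsPoitouTateSelmer.poitouTate_selmerStructure_duality_conj_holds`, P4 at 2 unconditional
p636231, P5 p635450, hybrid transverse package p635686, frame p640398, krr2-p2's
`kolyvaginCorankLowerBoundAtTwoRich_of_lossySwap` p640119). A one-line Theorems file `fun h ↦
KolyvaginCorankLowerBoundAtTwoRich_of_prop37 h` closes it (pen lands it this hour). Records that
V2♭∞ is REDUCED TO PRINT: 27984 ⇐ Prop37 ∧ (Prop37 ⇒ 27984). No summit proved. -/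
@[route_item "route-BirchSwinnertonDyer-KolyvaginRankRigidityAtTwo"]
def CorankLowerBoundAtTwoRichOfProp37 : Prop :=
  Prop37FrobeniusCongruenceAtTwo → KolyvaginCorankLowerBoundAtTwoRich

-- `CorankLowerBoundAtTwoRichOfProp37` holds: proved by `Summit.BirchSwinnertonDyer.BirchSwinnertonDyer.Theorems.KolyvaginRigidity.corankLowerBoundAtTwoRichOfProp37_proof` (its module imports this route file, so no `_holds` link can be stated here).

-- parent: KolyvaginCorankLowerBoundAtTwoRich · glue (gen 1)
/--     item stmt-BirchSwinnertonDyer-28230 · support · rank 303 · closed · proved by Summit.BirchSwinnertonDyer.BirchSwinnertonDyer.Theorems.KolyvaginRigidity.corankLowerBoundAtTwoRichOfPrintSplit_proof (planner)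
    parent: KolyvaginCorankLowerBoundAtTwoRich · GLUE: children ⟹ parent · by planner
R5-37 glue: Prop37FrobeniusCongruenceAtTwo → CorankLowerBoundAtTwoRichOfProp37 →
KolyvaginCorankLowerBoundAtTwoRich — modus ponens (`fun h g ↦ g h`, kernel-checked in folder
r37/sketch37.lean rc 0 together with the kernel half's by-name proof from p641767); the pen lands
both files the hour the items exist. -/
@[route_item "route-BirchSwinnertonDyer-KolyvaginRankRigidityAtTwo"]
def CorankLowerBoundAtTwoRichOfPrintSplit : Prop :=
  Prop37FrobeniusCongruenceAtTwo → CorankLowerBoundAtTwoRichOfProp37 → KolyvaginCorankLowerBoundAtTwoRich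

-- `CorankLowerBoundAtTwoRichOfPrintSplit` holds: proved by `Summit.BirchSwinnertonDyer.BirchSwinnertonDyer.Theorems.KolyvaginRigidity.corankLowerBoundAtTwoRichOfPrintSplit_proof` (its module imports this route file, so no `_holds` link can be stated here).

/-- item stmt-BirchSwinnertonDyer-24303 · crux · rank 4 · SPLIT (gen 1) into OffHabitatIrredNonSurjTwoConverse, OffHabitatRedNonSurjTwoConverse + glue OffHabitatNonSurjTwoConverseGlue · direct attempts still welcome (low priority) · by planner
why it might fail: It is the 2-converse for the 1207 WALL cells with ρ̄ onto S₃ but non-surjective 2-adic image plus all reducible/Borel-mod-2 cells: no method in print at p = 2 (Skinner–Urban/BSTW need p odd); as a residual it is only book-keeping, but it is open.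
sources: BurungaleSkinnerTianWan2024, arXiv:2409.01350, Skinner2016, RouseZureickBrown2015
[crux · RESIDUAL, replaces OffHabitatTwoConverse] the leaf NonCMTwoConverse OFF the rev-2 habitat:
curves whose 2-adic image is NOT surjective (some m with ρ_{E,2^m} non-surjective), both r = 0 and r
= 1. The r = 0 surjective cells, formerly residual, are now decided by V1+V2 (rev-2 closes).
Declared residual: imported complement, not attacked by this line. -/
@[route_item "route-BirchSwinnertonDyer-KolyvaginRankRigidityAtTwo", crux]
def OffHabitatNonSurjTwoConverse : Prop :=
  ∀ (W : WeierstrassCurve ℚ) [W.IsElliptic] [W.IsGloballyMinimal], ¬ W.HasCM → (Literature.NumberTheory.EllipticCurves.Rank1Residual.GoodOrd W 2 ∨ Literature.NumberTheory.EllipticCurves.Rank1Residual.Mult W 2) → ∀ r : ℕ, r ≤ 1 → W.selmerCorank 2 = r → ¬ (∀ m : ℕ, W.HasSurjectiveModNGaloisRep (2 ^ m : ℕ)) → W.analyticRank = r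

-- parent: OffHabitatNonSurjTwoConverse · child (gen 1)
/--     item stmt-BirchSwinnertonDyer-27123 · crux · rank 401 · open
    parent: OffHabitatNonSurjTwoConverse · by planner
    why it might fail: The finite-index defect of the Čebotarev eigenvector lemma / H¹(K(E[2^M])/K, E[2^M]) must be BOUNDED in M for fixed E (bet: Lie-algebra cohomology); if it grows with M for some RZB image, the ∃k of V2fin fails and the child needs an image-by-image statement.
    sources: Kolyvagin1991MathAnn, RouseZureickBrown2015, arXiv:1402.5997, GrossLMS1991, WZhang2014
[crux · LINE 8 «margin absorbs index», bsd-idea-1 g4] hR restricted to curves with E(ℚ)[2] = 0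
(ρ̄_{E,2} irreducible: image C₃ or S₃ mod 2) whose 2-adic image is NOT surjective (finite index > 1;
Rouse–Zureick-Brown: finitely many such images), both r = 0 and r = 1: Sel_{2^∞} corank r ⇒ analytic
rank r. ATTACKED child: the route's own V1′ₛ/V2♭ₘ + R4-closes machinery runs off the habitat once (∀
m, ρ_{E,2^m} onto) is replaced by irreducibility + finite index — Kolyvagin primes of every depth
exist because τ lies in the image, Gross admissibility follows from E(ℚ)[2] = 0, and the bounded
image defect (Kolyvagin 1991 works at finite index) is paid for by the margin k of V2♭ₘ, which is
already existential in (E, K). Registered skeleton MarginAbsorbsIndex: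
stub_noTwoTorsionOverK_of_irred (S) · stub_nonvanishingFiniteIndex (V1fin) ·
stub_corankRigidityFiniteIndexMargin (V2fin) · stub_printedInputs (by name) ⊢ child, kernel-checked
(rc 0, sorries = stubs). bears_on: LADDER S3 NonCMTwoConverse residual / W-ALL row 1 off-habitat
cells. No summit is proved by this line. -/
@[route_item "route-BirchSwinnertonDyer-KolyvaginRankRigidityAtTwo"]
def OffHabitatIrredNonSurjTwoConverse : Prop :=
  ∀ (W : WeierstrassCurve ℚ) [W.IsElliptic] [W.IsGloballyMinimal], ¬ W.HasCM → (Literature.NumberTheory.EllipticCurves.Rank1Residual.GoodOrd W 2 ∨ Literature.NumberTheory.EllipticCurves.Rank1Residual.Mult W 2) → ∀ r : ℕ, r ≤ 1 → W.selmerCorank 2 = r → ¬ (∀ m : ℕ, W.HasSurjectiveModNGaloisRep (2 ^ m : ℕ)) → AddSubgroup.torsionBy W.toAffine.Point (2 : ℤ) = ⊥ → W.analyticRank = r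

-- parent: OffHabitatNonSurjTwoConverse · child (gen 1)
/--     item stmt-BirchSwinnertonDyer-27124 · crux · rank 402 · open
    parent: OffHabitatNonSurjTwoConverse · by planner
    why it might fail: Open and with no method in print at 2: CGLS / Kriz–Li need p odd or give only the GZK direction; the abelian squeeze at 2 lacks Rubin's two-variable main conjecture for p | w_K. Residual book-keeping only.
    sources: arXiv:2008.02571, Greither1992, KrizLi2019, RouseZureickBrown2015
[crux · RESIDUAL of LINE 8] hR restricted to curves with a rational 2-torsion point (E(ℚ)[2] ≠ 0:
Eisenstein prime 2, 2-isogenous curves), both ranks. Declared residual: NOT attacked by this line.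
Named technique for a future line: Eisenstein-2 abelian squeeze (Selmer group of E pinned between
Selmer groups of the two characters of E[2]^{ss}; IMC over ℚ at p = 2 is Greither 1992; the K-side
abelian input at 2 (Rubin excludes p | w_K) is the open kernel), after Castella–Grossi–Lee–Skinner
at odd Eisenstein p. -/
@[route_item "route-BirchSwinnertonDyer-KolyvaginRankRigidityAtTwo"]
def OffHabitatRedNonSurjTwoConverse : Prop :=
  ∀ (W : WeierstrassCurve ℚ) [W.IsElliptic] [W.IsGloballyMinimal], ¬ W.HasCM → (Literature.NumberTheory.EllipticCurves.Rank1Residual.GoodOrd W 2 ∨ Literature.NumberTheory.EllipticCurves.Rank1Residual.Mult W 2) → ∀ r : ℕ, r ≤ 1 → W.selmerCorank 2 = r → ¬ (∀ m : ℕ, W.HasSurjectiveModNGaloisRep (2 ^ m : ℕ)) → AddSubgroup.torsionBy W.toAffine.Point (2 : ℤ) ≠ ⊥ → W.analyticRank = r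

-- parent: OffHabitatNonSurjTwoConverse · glue (gen 1)
/--     item stmt-BirchSwinnertonDyer-27125 · support · rank 403 · closed · proved by Summit.BirchSwinnertonDyer.BirchSwinnertonDyer.Theorems.KolyvaginRankRigidityGlue.offHabitatNonSurjTwoConverseGlue_proof (planner)
    parent: OffHabitatNonSurjTwoConverse · GLUE: children ⟹ parent · by planner
excluded middle on AddSubgroup.torsionBy W.toAffine.Point 2 = ⊥: = ⊥ → R_irr child; ≠ ⊥ → R_red
child — proved in the seat folder bc/Rirr_birth_local.lean
(offHabitatNonSurjTwoConverse_of_irred_of_red, rc 0), to be landed as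
Theorems/KolyvaginRankRigidityAtTwoOffHabitatSplit.lean -/
@[route_item "route-BirchSwinnertonDyer-KolyvaginRankRigidityAtTwo"]
def OffHabitatNonSurjTwoConverseGlue : Prop :=
  OffHabitatIrredNonSurjTwoConverse → OffHabitatRedNonSurjTwoConverse → OffHabitatNonSurjTwoConverse

-- `OffHabitatNonSurjTwoConverseGlue` holds: proved by `Summit.BirchSwinnertonDyer.BirchSwinnertonDyer.Theorems.KolyvaginRankRigidityGlue.offHabitatNonSurjTwoConverseGlue_proof` (its module imports this route file, so no `_holds` link can be stated here).

/-- item stmt-BirchSwinnertonDyer-24304 · crux · rank 9 · open · by planner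
why it might fail: In print (BFH 1990 Thm (i); FH 1995 Thm B); the only typing risk is the d_K % 8 = 1 clause, which is equivalent to `SatisfiesHeegnerHypothesis 2 K` for imaginary quadratic K (Neukirch I.8).
sources: BumpFriedbergHoffstein1990
[support · printed input] Bump–Friedberg–Hoffstein 1990 Thm (i) with S = primes(N) ∪ {2}: for w(E) =
+1 there are imaginary quadratic K of arbitrarily large |d_K| with every p | N split, 2 split (so
d_K ≡ 1 mod 8), and L(E^{(d_K)}, s) having a SIMPLE zero at s = 1. Provable now from the tree fact
`bumpFriedbergHoffstein_exists_heegnerField_split_twist_simpleZero` (S := {2} ∪ N.primeFactors) plus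
the splitting criterion 2 split in K ⇔ d_K ≡ 1 (mod 8). -/
@[route_item "route-BirchSwinnertonDyer-KolyvaginRankRigidityAtTwo"]
def SimpleZeroTwistSplitAtTwo : Prop :=
  ∀ (W : WeierstrassCurve ℚ) [W.IsElliptic], W.rootNumber = 1 → ∀ B : ℕ, ∃ (K : Type) (_ : Field K) (_ : NumberField K), Literature.NumberTheory.EllipticCurves.IsImaginaryQuadratic K ∧ B < (NumberField.discr K).natAbs ∧ Literature.NumberTheory.EllipticCurves.SatisfiesHeegnerHypothesis (W.conductorNorm ℤ) K ∧ Literature.NumberTheory.EllipticCurves.SatisfiesHeegnerHypothesis 2 K ∧ NumberField.discr K % 8 = 1 ∧ (W.quadraticTwist (NumberField.discr K : ℚ)).entireLFunction 1 = 0 ∧ deriv (W.quadraticTwist (NumberField.discr K : ℚ)).entireLFunction 1 ≠ 0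

/-- item stmt-BirchSwinnertonDyer-23948 · aside · rank 2 · open · by planner
why it might fail: Printed proofs need p ≥ 5: W. Zhang's mod p^M level raising (no admissible primes at 2; Chao Li's mod-2 rank-lowering obstruction at inert primes) and BCGS's IMC+BDP road (Iwasawa theory at 2); Gross's classes assume p odd for the eigen-splitting at Kolyvagin primes.
sources: WZhang2014, arXiv:2312.09301, Kolyvagin1991MathAnn, GrossLMS1991, doi:10.1093/imrn/rnx188, arXiv:1501.01344
[crux] [V1, card K1 — Kolyvagin's conjecture at p = 2] For non-CM E/ℚ (globally minimal W),
good-ordinary or multiplicative at 2, with SURJECTIVE 2-adic image (∀ m, ρ̄_(E,2^m) onto), and K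
imaginary quadratic with the Heegner hypothesis for N_E, d_K odd, d_K ≠ −3, E(K)[2] = 0 and 2 split
in K: there exist a modular parametrisation datum Dt, orientation β, ι : K → ℂ, a squarefree product
n of Kolyvagin primes (ℓ ∤ 2 N d_K inert, 2 | ℓ+1, 2 | a_ℓ: `Zhang2014.IsKolyvaginPrime … 2`), a
Kolyvagin–Heegner datum d of conductor n and a level 1 ≤ M ≤ M(n) with c_M(n) = `d.kolyvaginClass
Nat.prime_two M` ≠ 0 in H¹(K, E[2^M]). This is the tree fact K1 (BCGS Thm 1, `3 < p`) with p := 2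
and the ordinarity clause widened to the leaf's (GoodOrd ∨ Mult). [difficulty: XL] -/
@[route_item "route-BirchSwinnertonDyer-KolyvaginRankRigidityAtTwo"]
def KolyvaginNonvanishingAtTwo : Prop :=
  ∀ (W : WeierstrassCurve ℚ) [W.IsElliptic] [W.IsGloballyMinimal], ¬ W.HasCM → (Literature.NumberTheory.EllipticCurves.Rank1Residual.GoodOrd W 2 ∨ Literature.NumberTheory.EllipticCurves.Rank1Residual.Mult W 2) → (∀ m : ℕ, W.HasSurjectiveModNGaloisRep (2 ^ m : ℕ)) → ∀ (K : Type) [Field K] [NumberField K], Literature.NumberTheory.EllipticCurves.IsImaginaryQuadratic K → ∀ [NeZero (W.conductorNorm ℤ)], Literature.NumberTheory.EllipticCurves.SatisfiesHeegnerHypothesis (W.conductorNorm ℤ) K → Odd (NumberField.discr K) → NumberField.discr K ≠ -3 → AddSubgroup.torsionBy (W.baseChange K).toAffine.Point (2 : ℤ) = ⊥ → Literature.NumberTheory.EllipticCurves.SatisfiesHeegnerHypothesis 2 K → ∃ (Dt : Literature.NumberTheory.EllipticCurves.ModularForms.ModularParametrizationData W (W.conductorNorm ℤ)) (β : ℤ)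 (ι : K →+* ℂ) (n : ℕ) (d : Literature.NumberTheory.EllipticCurves.KolyvaginHeegnerData Dt β ι n) (M : ℕ), Literature.NumberTheory.EllipticCurves.KolyvaginDescent.KolSupp (Literature.NumberTheory.EllipticCurves.Zhang2014.IsKolyvaginPrime (W.conductorNorm ℤ) W K 2) n ∧ 1 ≤ M ∧ (M : ℕ∞) ≤ Literature.NumberTheory.EllipticCurves.Zhang2014.levelIndex W 2 n ∧ d.kolyvaginClass Nat.prime_two M ≠ 0

/-- item stmt-BirchSwinnertonDyer-24622 · aside · rank 2 · open · by planner
why it might fail: Kolyvagin's conjecture is a theorem only for odd p (W. Zhang 2014 p ≥ 5 + hypotheses; Burungale–Castella–Grossi–Skinner p odd); at p = 2 the Čebotarev choice of Kolyvagin primes (Frob = τ on K(E[2^M])) and the Gross–Kolyvagin sign/2-torsion bookkeeping have no printed treatment; XL wall.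
sources: Kolyvagin1991MathAnn
[V1′ = V1 repaired to the UNIVERSAL FRAME (VET TK5G, bsd-vet-tk5g g0, 2026-08-28T01:34Z); replaces
23948 `KolyvaginNonvanishingAtTwo`, which goes aside] Kolyvagin's conjecture at p = 2 on the
surjective-2-adic-image habitat: for non-CM E/ℚ good-ordinary-or-multiplicative at 2 with ρ_{E,2^m}
onto for all m, K imaginary quadratic Heegner for N_E with odd d_K ≠ −3, E(K)[2] = 0 and 2 split in
K, and for EVERY modular parametrisation datum Dt, orientation β (4N | β² − d_K) and embedding ι,
some Kolyvagin class c_M(n) at 2 (n supported on Kolyvagin primes at 2, 1 ≤ M ≤ M(n)) is non-zero.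
The frame (Dt, β, ι) is quantified universally exactly as FACT K1 (Burungale et al.) is consumed and
as V2 is stated, so a prover no longer has to CONSTRUCT a parametrisation (= modularity) to land it;
`closes` supplies the frame from NewformOfEllipticCurve via the PROVED
nonempty_modularParametrizationData_of_isNewformOf and exists_dvd_sq_sub_discr_holds
(kernel-checked: vet file W2394x.lean `v1_of_frame`, `closes_of_frame`). BSD is not proved by this. -/
@[route_item "route-BirchSwinnertonDyer-KolyvaginRankRigidityAtTwo"]
def KolyvaginNonvanishingAtTwoFrame : Prop :=
  ∀ (W : WeierstrassCurve ℚ) [W.IsElliptic] [W.IsGloballyMinimal], ¬ W.HasCM → (Literature.NumberTheory.EllipticCurves.Rank1Residual.GoodOrd W 2 ∨ Literature.NumberTheory.EllipticCurves.Rank1Residual.Mult W 2) → (∀ m : ℕ, W.HasSurjectiveModNGaloisRep (2 ^ m : ℕ)) → ∀ (K : Type) [Field K] [NumberField K], Literature.NumberTheory.EllipticCurves.IsImaginaryQuadratic K → ∀ [NeZero (W.conductorNorm ℤ)], Literature.NumberTheory.EllipticCurves.SatisfiesHeegnerHypothesis (W.conductorNorm ℤ) K → Odd (NumberField.discr K)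 → NumberField.discr K ≠ -3 → AddSubgroup.torsionBy (W.baseChange K).toAffine.Point (2 : ℤ) = ⊥ → Literature.NumberTheory.EllipticCurves.SatisfiesHeegnerHypothesis 2 K → ∀ (Dt : Literature.NumberTheory.EllipticCurves.ModularForms.ModularParametrizationData W (W.conductorNorm ℤ)) (β : ℤ) (ι : K →+* ℂ), (4 * (W.conductorNorm ℤ : ℤ)) ∣ β ^ 2 - NumberField.discr K → ∃ (n : ℕ) (d : Literature.NumberTheory.EllipticCurves.KolyvaginHeegnerData Dt β ι n) (M : ℕ), Literature.NumberTheory.EllipticCurves.KolyvaginDescent.KolSupp (Literature.NumberTheory.EllipticCurves.Zhang2014.IsKolyvaginPrime (W.conductorNorm ℤ) W K 2) n ∧ 1 ≤ M ∧ (M : ℕ∞) ≤ Literature.NumberTheory.EllipticCurves.Zhang2014.levelIndex W 2 n ∧ d.kolyvaginClass Nat.prime_two M ≠ 0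

/-- item stmt-BirchSwinnertonDyer-27014 · support · rank 2 · open · by planner
why it might fail: Kolyvagin's conjecture at 2 is open even at margin 0 (Zhang 2014 / BCGS need p odd); the ∀k form also needs level-index supply (Čebotarev for Kolyvagin primes with M(ℓ) ≥ M+k) with the class STAYING non-zero at deeper primes — not automatic from margin 0.
sources: Kolyvagin1991MathAnn, WZhang2014
[crux] [V1′ₛ, R4 margin form of V1′ 24622; pen bsd-idea-1, LEAD krr2-p1] Kolyvagin's conjecture at p
= 2 in STRONG (margin) form on the surjective-2-adic Heegner habitat (non-CM, good ordinary or
multiplicative 2, ρ_{E,2^m} onto for all m, K imaginary quadratic with Heegner hypothesis, odd d_K ≠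
−3, E(K)[2] = 0): for the universal frame (Dt, β, ι) and EVERY margin k there are a Kolyvagin
conductor n, a datum d and a level M with 1 ≤ M, M + k ≤ M(n) = levelIndex and c_M(n) =
d.kolyvaginClass 2 M ≠ 0. Margin 0 = today's V1′ (implied: frame_of_strong in the turnkey).
Numerically witnessed at margins 1–2 (KOLY2 v4: 1621a1 ℓ = 3, 31; 718b1 ℓ = 47). No summit is proved
by this item. -/
@[route_item "route-BirchSwinnertonDyer-KolyvaginRankRigidityAtTwo"]
def KolyvaginNonvanishingAtTwoFrameStrong : Prop :=
  ∀ (W : WeierstrassCurve ℚ) [W.IsElliptic] [W.IsGloballyMinimal], ¬ W.HasCM → (Literature.NumberTheory.EllipticCurves.Rank1Residual.GoodOrd W 2 ∨ Literature.NumberTheory.EllipticCurves.Rank1Residual.Mult W 2) → (∀ m : ℕ, W.HasSurjectiveModNGaloisRep (2 ^ m : ℕ)) → ∀ (K : Type) [Field K] [NumberField K], Literature.NumberTheory.EllipticCurves.IsImaginaryQuadratic K → ∀ [NeZero (W.conductorNorm ℤ)], Literature.NumberTheory.EllipticCurves.SatisfiesHeegnerHypothesis (W.conductorNorm ℤ)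 K → Odd (NumberField.discr K) → NumberField.discr K ≠ -3 → AddSubgroup.torsionBy (W.baseChange K).toAffine.Point (2 : ℤ) = ⊥ → Literature.NumberTheory.EllipticCurves.SatisfiesHeegnerHypothesis 2 K → ∀ (Dt : Literature.NumberTheory.EllipticCurves.ModularForms.ModularParametrizationData W (W.conductorNorm ℤ)) (β : ℤ) (ι : K →+* ℂ), (4 * (W.conductorNorm ℤ : ℤ)) ∣ β ^ 2 - NumberField.discr K → ∀ k : ℕ, ∃ (n : ℕ) (d : Literature.NumberTheory.EllipticCurves.KolyvaginHeegnerData Dt β ι n) (M : ℕ), Literature.NumberTheory.EllipticCurves.KolyvaginDescent.KolSupp (Literature.NumberTheory.EllipticCurves.Zhang2014.IsKolyvaginPrime (W.conductorNorm ℤ) W K 2) n ∧ 1 ≤ M ∧ ((M + k : ℕ) : ℕ∞) ≤ Literature.NumberTheory.EllipticCurves.Zhang2014.levelIndex W 2 n ∧ d.kolyvaginClass Nat.prime_two M ≠ 0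

/-- item stmt-BirchSwinnertonDyer-27219 · support · rank 2 · open · by planner
why it might fail: In the torsion-y_K regime it is Kolyvagin's conjecture at 2 in strong form with index ≥ θ·level: needs deep Kolyvagin primes (Čebotarev, free) AND the class staying non-zero there — W. Zhang's p ≥ 5 proof has no anchor at 2.
sources: Kolyvagin1991MathAnn, WZhang2014, GrossLMS1991
[crux · V1′θ, pen ruling R4-θ] Kolyvagin's conjecture at 2 in RELATIVE-MARGIN form on the surjective
habitat and the universal frame: for every θ, k a non-zero class c_M(n) with θ·M + k ≤ M(n) (index
exceeds θ × level by k). Supersedes V1′ₛ (27014, additive margin; implied at θ = 1) and V1′ (24622;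
θ = 1, k = 0, `frame_of_theta`). Text VERBATIM from the LEAD's kernel-checked turnkey
Cruxes/KolyvaginCorankLowerBoundAtTwo/MARGIN_RESTATEMENT_THETA.lean (krr2-p1 g7, commit
775a89b0d268); bsd-2adic S3 mirror edit-19220-v3theta.json byte-identical ⇒ one cone. Level-one case
(P(1) of infinite order) is free (M(1) = ∞); the torsion-y_K case is the research content. No summit
is proved by this. -/
@[route_item "route-BirchSwinnertonDyer-KolyvaginRankRigidityAtTwo", crux]
def KolyvaginNonvanishingAtTwoFrameTheta : Prop :=
  ∀ (W : WeierstrassCurve ℚ) [W.IsElliptic] [W.IsGloballyMinimal], ¬ W.HasCM → (Literature.NumberTheory.EllipticCurves.Rank1Residual.GoodOrd W 2 ∨ Literature.NumberTheory.EllipticCurves.Rank1Residual.Mult W 2) → (∀ m : ℕ, W.HasSurjectiveModNGaloisRep (2 ^ m : ℕ)) → ∀ (K : Type) [Field K] [NumberField K], Literature.NumberTheory.EllipticCurves.IsImaginaryQuadratic K → ∀ [NeZero (W.conductorNorm ℤ)], Literature.NumberTheory.EllipticCurves.SatisfiesHeegnerHypothesis (W.conductorNorm ℤ) K → Odd (NumberField.discr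 K) → NumberField.discr K ≠ -3 → AddSubgroup.torsionBy (W.baseChange K).toAffine.Point (2 : ℤ) = ⊥ → Literature.NumberTheory.EllipticCurves.SatisfiesHeegnerHypothesis 2 K → ∀ (Dt : Literature.NumberTheory.EllipticCurves.ModularForms.ModularParametrizationData W (W.conductorNorm ℤ)) (β : ℤ) (ι : K →+* ℂ), (4 * (W.conductorNorm ℤ : ℤ)) ∣ β ^ 2 - NumberField.discr K → ∀ θ k : ℕ, ∃ (n : ℕ) (d : Literature.NumberTheory.EllipticCurves.KolyvaginHeegnerData Dt β ι n) (M : ℕ), Literature.NumberTheory.EllipticCurves.KolyvaginDescent.KolSupp (Literature.NumberTheory.EllipticCurves.Zhang2014.IsKolyvaginPrime (W.conductorNorm ℤ) W K 2) n ∧ 1 ≤ M ∧ ((θ * M + k : ℕ) : ℕ∞) ≤ Literature.NumberTheory.EllipticCurves.Zhang2014.levelIndex W 2 n ∧ d.kolyvaginClass Nat.prime_two M ≠ 0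

/-- item stmt-BirchSwinnertonDyer-23949 · aside · rank 3 · open · by planner
why it might fail: Kolyvagin 1991 Thm 4 assumes ℓ odd: the induction splits H¹(K, E[ℓ^M]) and the local groups at Kolyvagin primes into ±-eigenspaces of τ and uses Cassels–Tate alternation; at 2 the eigenvalues ±1 collide and each step loses 2-torsion — the bet: only bounded errors, invisible on coranks.
sources: Kolyvagin1991MathAnn, WZhang2014, McCallumLMS1991, GrossLMS1991, arXiv:2203.12159, arXiv:2505.09121
[crux] [V2, card K2 — Kolyvagin's structure theorem at p = 2, on coranks] Same curve habitat; K
imaginary quadratic with d_K ≠ −3, −4, 2 ∤ d_K and the Heegner hypothesis; for any datum (Dt, β, ι),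
any non-zero class c_M(n) ≠ 0 (n Kolyvagin-squarefree at 2, 1 ≤ M ≤ M(n)) whose depth ν = #(prime
factors of n) is MINIMAL among the non-zero classes of the system: either corank_(ℤ₂) Sel_(2^∞)(E/ℚ)
= ν + 1 ∧ corank_(ℤ₂) Sel_(2^∞)(E^(d_K)/ℚ) ≤ ν, or corank Sel_(2^∞)(E^(d_K)/ℚ) = ν + 1 ∧ corank
Sel_(2^∞)(E/ℚ) ≤ ν. This is the tree fact K2 (Kolyvagin 1991 Thm 4 / W. Zhang Thm 11.2 (i), `5 ≤ p`,
ρ̄_(E,p) onto, p ∤ N) with p := 2, 2-ADIC surjectivity in place of mod-p surjectivity, (GoodOrd ∨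
Mult at 2) in place of p ∤ N, and Kolyvagin's parity clauses `Even (ν − c′)` dropped (the assembly
does not use them). [deps: KolyvaginNonvanishingAtTwo] [difficulty: L] -/
@[route_item "route-BirchSwinnertonDyer-KolyvaginRankRigidityAtTwo"]
def KolyvaginCorankRigidityAtTwo : Prop :=
  ∀ (W : WeierstrassCurve ℚ) [W.IsElliptic] [W.IsGloballyMinimal], ¬ W.HasCM → (Literature.NumberTheory.EllipticCurves.Rank1Residual.GoodOrd W 2 ∨ Literature.NumberTheory.EllipticCurves.Rank1Residual.Mult W 2) → (∀ m : ℕ, W.HasSurjectiveModNGaloisRep (2 ^ m : ℕ)) → ∀ (K : Type) [Field K] [NumberField K], Literature.NumberTheory.EllipticCurves.IsImaginaryQuadratic K → NumberField.discr K ≠ -3 → NumberField.discr K ≠ -4 → ¬ ((2 : ℤ) ∣ NumberField.discr K) → ∀ [NeZero (W.conductorNorm ℤ)], Literature.NumberTheory.EllipticCurves.SatisfiesHeegnerHypothesis (W.conductorNorm ℤ) K → ∀ (Dt : Literature.NumberTheory.EllipticCurves.ModularForms.ModularParametrizationData W (W.conductorNorm ℤ)) (β : ℤ) (ι : K →+*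 ℂ) (n : ℕ) (d : Literature.NumberTheory.EllipticCurves.KolyvaginHeegnerData Dt β ι n) (M : ℕ), Literature.NumberTheory.EllipticCurves.KolyvaginDescent.KolSupp (Literature.NumberTheory.EllipticCurves.Zhang2014.IsKolyvaginPrime (W.conductorNorm ℤ) W K 2) n → 1 ≤ M → (M : ℕ∞) ≤ Literature.NumberTheory.EllipticCurves.Zhang2014.levelIndex W 2 n → d.kolyvaginClass Nat.prime_two M ≠ 0 → (∀ (n' : ℕ) (d' : Literature.NumberTheory.EllipticCurves.KolyvaginHeegnerData Dt β ι n') (M' : ℕ), Literature.NumberTheory.EllipticCurves.KolyvaginDescent.KolSupp (Literature.NumberTheory.EllipticCurves.Zhang2014.IsKolyvaginPrime (W.conductorNorm ℤ) W K 2) n' → 1 ≤ M' → (M' : ℕ∞) ≤ Literature.NumberTheory.EllipticCurves.Zhang2014.levelIndex W 2 n' → d'.kolyvaginClass Nat.prime_two M' ≠ 0 → n.primeFactors.card ≤ n'.primeFactors.card) → ((W.selmerCorank 2 = n.primeFactors.card + 1 ∧ (W.quadraticTwist (NumberField.discr K : ℚ)).selmerCorank 2 ≤ n.primeFactors.card)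 ∨ ((W.quadraticTwist (NumberField.discr K : ℚ)).selmerCorank 2 = n.primeFactors.card + 1 ∧ W.selmerCorank 2 ≤ n.primeFactors.card))

/-- item stmt-BirchSwinnertonDyer-24623 · aside · rank 3 · open · by planner
why it might fail: The p = 2 port of Zhang's Lemma 8.4 needs Čebotarev one level up (H¹(GL₂(ℤ/2^M),(ℤ/2^M)²) ≠ 0 for M ≥ 2, memo) and loses 1 bit in the local pairing when τ swaps P ± Q; Kolyvagin 1991 §2 asserts the ℓ = 2 structure theory only up to bounded index ℓ^{k₂}, without proof.
sources: Kolyvagin1991MathAnn, McCallumLMS1991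
[V2♭ = the LOWER-BOUND half of V2 (lead krr2-p1 tree file
Cruxes/KolyvaginCorankRigidityAtTwo/WeakeningV2LowerBound.lean `DepthLowerBoundAtTwo`, krr2-p2
TURNKEY 01:52Z); replaces 23949 `KolyvaginCorankRigidityAtTwo`, which goes aside] Same habitat and
binders as V2; conclusion weakened from the dichotomy {max(c,c′) = ν+1, min ≤ ν} to ν + 1 ≤ c ∨ ν +
1 ≤ c′ (c, c′ = corank Sel_{2^∞} of E and E^{(d_K)}, ν = minimal depth of a non-zero Kolyvagin class
at 2): Kolyvagin 1991 (Math. Ann. 291) Thm 2.2 / W. Zhang 2014 Lemma 8.4 direction (independent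
classes at minimal depth), asked at p = 2. The route's deciding theorem consumed only this half
(kernel finding `closes_of_depthLowerBound`); Kolyvagin's DESCENT half is idle for the leaf and is
dropped from the crux. Registered line kolyvagin_depth_split (stub_depthZero LANDED p594032 +
stub_lowerBoundMinimalPosDepth) re-keys to this decl. BSD is not proved by this. -/
@[route_item "route-BirchSwinnertonDyer-KolyvaginRankRigidityAtTwo"]
def KolyvaginCorankLowerBoundAtTwo : Prop :=
  ∀ (W : WeierstrassCurve ℚ) [W.IsElliptic] [W.IsGloballyMinimal], ¬ W.HasCM → (Literature.NumberTheory.EllipticCurves.Rank1Residual.GoodOrd W 2 ∨ Literature.NumberTheory.EllipticCurves.Rank1Residual.Mult W 2) → (∀ m : ℕ, W.HasSurjectiveModNGaloisRep (2 ^ m : ℕ)) → ∀ (K : Type) [Field K] [NumberField K], Literature.NumberTheory.EllipticCurves.IsImaginaryQuadratic K → NumberField.discr K ≠ -3 → NumberField.discr K ≠ -4 → ¬ ((2 : ℤ) ∣ NumberField.discr K) → ∀ [NeZero (W.conductorNorm ℤ)], Literature.NumberTheory.EllipticCurves.SatisfiesHeegnerHypothesis (W.conductorNorm ℤ) K → ∀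 (Dt : Literature.NumberTheory.EllipticCurves.ModularForms.ModularParametrizationData W (W.conductorNorm ℤ)) (β : ℤ) (ι : K →+* ℂ) (n : ℕ) (d : Literature.NumberTheory.EllipticCurves.KolyvaginHeegnerData Dt β ι n) (M : ℕ), Literature.NumberTheory.EllipticCurves.KolyvaginDescent.KolSupp (Literature.NumberTheory.EllipticCurves.Zhang2014.IsKolyvaginPrime (W.conductorNorm ℤ) W K 2) n → 1 ≤ M → (M : ℕ∞) ≤ Literature.NumberTheory.EllipticCurves.Zhang2014.levelIndex W 2 n → d.kolyvaginClass Nat.prime_two M ≠ 0 → (∀ (n' : ℕ) (d' : Literature.NumberTheory.EllipticCurves.KolyvaginHeegnerData Dt β ι n') (M' : ℕ), Literature.NumberTheory.EllipticCurves.KolyvaginDescent.KolSupp (Literature.NumberTheory.EllipticCurves.Zhang2014.IsKolyvaginPrime (W.conductorNorm ℤ) W K 2) n' → 1 ≤ M' → (M' : ℕ∞) ≤ Literature.NumberTheory.EllipticCurves.Zhang2014.levelIndex W 2 n' → d'.kolyvaginClass Nat.prime_two M' ≠ 0 → n.primeFactors.card ≤ n'.primeFactors.card) → (n.primeFactors.card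 + 1 ≤ W.selmerCorank 2 ∨ n.primeFactors.card + 1 ≤ (W.quadraticTwist (NumberField.discr K : ℚ)).selmerCorank 2)

/-- item stmt-BirchSwinnertonDyer-27015 · aside · rank 3 · open · by planner
why it might fail: Thm 2.2/2.3 at ℓ = 2 are not in print (Kolyvagin asserts the ℓ ∉ B(E) theory only up to bounded index); the prime-replacement step at 2 loses O(1) bits per step (phantom ℤ/2 class, (1 ± τ)-eigenvector Čebotarev, local pairing of order 2^{M−1}); the bit budget D = 3 is a claim, not a theorem.
sources: Kolyvagin1991MathAnn
[crux] [V2♭ₘ, R4 margin form of V2♭ 24623; LEAD krr2-p1 line kolyvagin_depth_split re-keys here]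
Kolyvagin's corank LOWER BOUND at 2 WITH MARGIN: on the same habitat (plus d_K ≠ −4, 2 ∤ d_K) there
is a margin k (depending on E, K) such that for every frame and every non-zero class c_M(n) with 1 ≤
M, M + k ≤ M(n) whose depth ν(n) is minimal among such margin-k classes, ν + 1 ≤ c ∨ ν + 1 ≤ c′ (c,
c′ the 2^∞-Selmer coranks of the ± eigenspaces over K). V2♭ ⇒ V2♭ₘ (k = 0; margin_of_lowerBound).
The margin is what the depth-split line needs: its prime-replacement step at 2 loses O(1) bits
(phantom ℤ/2 inflation class, (1 ± τ)-eigenvector Čebotarev, local pairing of order 2^(M−1)). No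
summit is proved by this item. -/
@[route_item "route-BirchSwinnertonDyer-KolyvaginRankRigidityAtTwo"]
def KolyvaginCorankLowerBoundAtTwoMargin : Prop :=
  ∀ (W : WeierstrassCurve ℚ) [W.IsElliptic] [W.IsGloballyMinimal], ¬ W.HasCM → (Literature.NumberTheory.EllipticCurves.Rank1Residual.GoodOrd W 2 ∨ Literature.NumberTheory.EllipticCurves.Rank1Residual.Mult W 2) → (∀ m : ℕ, W.HasSurjectiveModNGaloisRep (2 ^ m : ℕ)) → ∀ (K : Type) [Field K] [NumberField K], Literature.NumberTheory.EllipticCurves.IsImaginaryQuadratic K → NumberField.discr K ≠ -3 → NumberField.discr K ≠ -4 → ¬ ((2 : ℤ) ∣ NumberField.discr K) → ∀ [NeZero (W.conductorNorm ℤ)], Literature.NumberTheory.EllipticCurves.SatisfiesHeegnerHypothesis (W.conductorNorm ℤ) K → ∃ k : ℕ, ∀ (Dt : Literature.NumberTheory.EllipticCurves.ModularForms.ModularParametrizationData W (W.conductorNorm ℤ)) (β : ℤ) (ι : K →+* ℂ) (n : ℕ) (d : Literature.NumberTheory.EllipticCurves.KolyvaginHeegnerData Dt β ι n) (M : ℕ),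 Literature.NumberTheory.EllipticCurves.KolyvaginDescent.KolSupp (Literature.NumberTheory.EllipticCurves.Zhang2014.IsKolyvaginPrime (W.conductorNorm ℤ) W K 2) n → 1 ≤ M → ((M + k : ℕ) : ℕ∞) ≤ Literature.NumberTheory.EllipticCurves.Zhang2014.levelIndex W 2 n → d.kolyvaginClass Nat.prime_two M ≠ 0 → (∀ (n' : ℕ) (d' : Literature.NumberTheory.EllipticCurves.KolyvaginHeegnerData Dt β ι n') (M' : ℕ), Literature.NumberTheory.EllipticCurves.KolyvaginDescent.KolSupp (Literature.NumberTheory.EllipticCurves.Zhang2014.IsKolyvaginPrime (W.conductorNorm ℤ) W K 2) n' → 1 ≤ M' → ((M' + k : ℕ) : ℕ∞) ≤ Literature.NumberTheory.EllipticCurves.Zhang2014.levelIndex W 2 n' → d'.kolyvaginClass Nat.prime_two M' ≠ 0 → n.primeFactors.card ≤ n'.primeFactors.card) → (n.primeFactors.card + 1 ≤ W.selmerCorank 2 ∨ n.primeFactors.card + 1 ≤ (W.quadraticTwist (NumberField.discr K : ℚ)).selmerCorank 2)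

/-- item stmt-BirchSwinnertonDyer-27220 · support · rank 3 · open · by planner
why it might fail: Method-unreachable as typed (LEAD krr2-p1 g7/g8 SWAP-LEDGER: each seed-phase prime swap at 2 may lose ≤ 3 bits, so no fixed (θ,k) serves all depths ν — needs k = k(ν)); superseded as load-bearing by V2♭∞ 27984 (rev 25); stays crux only while the LEAD seat is keyed to it.
sources: Kolyvagin1991MathAnn, McCallumLMS1991, WZhang2014, Howard2004
[crux · V2♭θ, pen ruling R4-θ] the corank lower bound at 2 for classes WITH RELATIVE MARGIN: ∃ θ k
(per E, K; θ = 2, k = O(1) expected) such that a non-zero class c_M(n) with θ·M + k ≤ M(n), of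
minimal depth among such classes, has ν + 1 ≤ c ∨ ν + 1 ≤ c′ — Kolyvagin's Thm 2.2 for a general
base p₀ under θ·m_f < m(p₀) (Math. Ann. 291 p. 257), at the prime 2. Supersedes V2♭ₘ (27015,
additive margin): the LEAD's MARGIN_THETA v2 shows the prime swap at level 2^M from ν = 2 on is
informative for every seed only when the propagated class has relative order > 1/2 (A_best ≥
2^{M/2}), which the additive margin does not guarantee; with the relative margin the swap at 2 is
lossless in both signs of Δ_E, so k is a constant. Text VERBATIM from MARGIN_RESTATEMENT_THETA.lean;
LEAD krr2-p1 re-registers Lines/kolyvagin_depth_split here (T1 ⇐ Q2, T5⁺θ). No summit is proved by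
this. -/
@[route_item "route-BirchSwinnertonDyer-KolyvaginRankRigidityAtTwo"]
def KolyvaginCorankLowerBoundAtTwoTheta : Prop :=
  ∀ (W : WeierstrassCurve ℚ) [W.IsElliptic] [W.IsGloballyMinimal], ¬ W.HasCM → (Literature.NumberTheory.EllipticCurves.Rank1Residual.GoodOrd W 2 ∨ Literature.NumberTheory.EllipticCurves.Rank1Residual.Mult W 2) → (∀ m : ℕ, W.HasSurjectiveModNGaloisRep (2 ^ m : ℕ)) → ∀ (K : Type) [Field K] [NumberField K], Literature.NumberTheory.EllipticCurves.IsImaginaryQuadratic K → NumberField.discr K ≠ -3 → NumberField.discr K ≠ -4 → ¬ ((2 : ℤ) ∣ NumberField.discr K) → ∀ [NeZero (W.conductorNorm ℤ)], Literature.NumberTheory.EllipticCurves.SatisfiesHeegnerHypothesis (W.conductorNorm ℤ) K → ∃ θ k : ℕ, ∀ (Dt : Literature.NumberTheory.EllipticCurves.ModularForms.ModularParametrizationData W (W.conductorNorm ℤ)) (β : ℤ) (ι : K →+* ℂ) (n : ℕ) (d : Literature.NumberTheory.EllipticCurves.KolyvaginHeegnerData Dt β ι n) (M : ℕ), Literature.NumberTheory.EllipticCurves.KolyvaginDescent.KolSupp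 (Literature.NumberTheory.EllipticCurves.Zhang2014.IsKolyvaginPrime (W.conductorNorm ℤ) W K 2) n → 1 ≤ M → ((θ * M + k : ℕ) : ℕ∞) ≤ Literature.NumberTheory.EllipticCurves.Zhang2014.levelIndex W 2 n → d.kolyvaginClass Nat.prime_two M ≠ 0 → (∀ (n' : ℕ) (d' : Literature.NumberTheory.EllipticCurves.KolyvaginHeegnerData Dt β ι n') (M' : ℕ), Literature.NumberTheory.EllipticCurves.KolyvaginDescent.KolSupp (Literature.NumberTheory.EllipticCurves.Zhang2014.IsKolyvaginPrime (W.conductorNorm ℤ) W K 2) n' → 1 ≤ M' → ((θ * M' + k : ℕ) : ℕ∞) ≤ Literature.NumberTheory.EllipticCurves.Zhang2014.levelIndex W 2 n' → d'.kolyvaginClass Nat.prime_two M' ≠ 0 → n.primeFactors.card ≤ n'.primeFactors.card) → (n.primeFactors.card + 1 ≤ W.selmerCorank 2 ∨ n.primeFactors.card + 1 ≤ (W.quadraticTwist (NumberField.discr K : ℚ)).selmerCorank 2)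

/-- item stmt-BirchSwinnertonDyer-23950 · aside · rank 4 · open · by planner
why it might fail: It is an open problem: r = 0 is TwoAdicConverse's territory (Iwasawa/Eisenstein inputs at 2), and r = 1 off the surjective image needs a residually-reducible/small-image Kolyvagin argument at 2 that nobody has; declared residual.
sources: arXiv:1402.5997, DokchitserDokchitserMathZ2012, arXiv:1405.7294, arXiv:2006.11519
[crux] [R, residual — declared complement, not attacked by this line] The leaf OFF the habitat: r =
0 (corank 0 ⇒ analytic rank 0: exactly route TwoAdicConverse's cruxes
GoodOrdinaryRankZeroTwoConverse / MultiplicativeRankZeroTwoConverse), and r = 1 for curves whose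
2-adic image is NOT surjective (the 1207 non-maximal 2-adic images of Rouse–Zureick-Brown, incl.
every curve with a rational 2-torsion point or a rational 2-isogeny). Listed so that `closes` is
honest; served to nobody by this route. [difficulty: open-problem] -/
@[route_item "route-BirchSwinnertonDyer-KolyvaginRankRigidityAtTwo"]
def OffHabitatTwoConverse : Prop :=
  ∀ (W : WeierstrassCurve ℚ) [W.IsElliptic] [W.IsGloballyMinimal], ¬ W.HasCM → (Literature.NumberTheory.EllipticCurves.Rank1Residual.GoodOrd W 2 ∨ Literature.NumberTheory.EllipticCurves.Rank1Residual.Mult W 2) → ∀ r : ℕ, r ≤ 1 → W.selmerCorank 2 = r → ¬ (r = 1 ∧ (∀ m : ℕ, W.HasSurjectiveModNGaloisRep (2 ^ m : ℕ))) → W.analyticRank = r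

/-- item stmt-BirchSwinnertonDyer-19273 · support · rank 9 · open · by planner
[support] entire continuation of L(E/ℚ, s) (modularity: Breuil–Conrad–Diamond–Taylor 2001 Thm A +
Hecke/Shimura), BY NAME — conjunct of MultConversePublishedInputsAtTwo (19185); same content, filed
so the head constant is item-stated (#15c one rule; cite_only dep) -/
@[route_item "route-BirchSwinnertonDyer-KolyvaginRankRigidityAtTwo", crux]
def EntireLFunctionRat : Prop :=
  WeierstrassCurve.hasEntireLFunction_rat

/-- item stmt-BirchSwinnertonDyer-19372 · support · rank 9 · open · by planner
[aside] Hoffstein–Luo 1997 Theorem (§1, pp. 435–436), as used in Matsuno 2009 proof of Prop. 6.1: a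
quadratic twist with L(E^D,1) ≠ 0 under prescribed local conditions — conjunct of
PublishedInputsFive (stmt-BirchSwinnertonDyer-19066) kept inside the k = 7 rest child
ClassicalAndTwistInputsFive and item-stated here BY NAME as an ASIDE (banked context, never staffed,
BC6-exempt) so the cite_only dep is declared (#15c); no crux statement / closes / tribunal change -/
@[route_item "route-BirchSwinnertonDyer-KolyvaginRankRigidityAtTwo", crux]
def HoffsteinLuoNonvanishingTwist : Prop :=
  Literature.NumberTheory.EllipticCurves.HoffsteinLuo1997_exists_twist_L_one_ne_zero

/-- item stmt-BirchSwinnertonDyer-19382 · support · rank 9 · open · by planner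
[support] Modularity Theorem, Version L (Diamond–Shurman 2005 Thm. 8.8.3; Wiles / Taylor–Wiles /
BCDT 2001 Thm. A): every E/ℚ has a weight-2 newform f of level N_E with L(f,s) = L(E,s) — conjunct
of PublishedInputsFive (stmt-BirchSwinnertonDyer-19066), BY NAME; same content, filed as a split
child so the head constant is item-stated (gate5 #15c one rule / readiness rule 2026-08-15: a
cite_only dep must be declared by the route); no crux statement / closes / tribunal / tribunal_fit
change -/
@[route_item "route-BirchSwinnertonDyer-KolyvaginRankRigidityAtTwo", crux]
def NewformOfEllipticCurve : Prop :=
  Literature.NumberTheory.EllipticCurves.ModularForms.exists_isNewformOf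

/-- item stmt-BirchSwinnertonDyer-19921 · support · rank 9 · open · by operator
why it might fail: In print (Gross–Zagier 1986, Kolyvagin 1990 + BFH/MM); a named Literature fact of the tree.
sources: GrossZagier1986, Kolyvagin1990, BumpFriedbergHoffstein1990
[support] The one PUBLISHED input the halves-glue consumes: Gross–Zagier–Kolyvagin, rank = analytic
rank for analytic rank ≤ 1 with Ш finite (tree named fact
rank_eq_analyticRank_of_analyticRank_le_one; used by bsdp_of_missingPPartAt to turn Miller's last
clause into BSD(E,2)). Carried as a displayed PUB hypothesis; never counted as progress. The further
PRINT of the roads to the two halves (Greenberg Thm-4.1 analogues at a multiplicative prime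
thm41Analogue_charValue_rankZero_numberField_anyPrime / …_split_baseChange_anyPrime, modularity) and
the referee-passed MEMO inputs (Kato ⊗ℚ at a multiplicative 2:
X5.O1.KatoMultiplicativeDivisibilityRat W 2, HOME mult/PROOF-MULT.md RC-2; Greenberg–Stevens at 2:
greenberg_stevens W 2, mult/PROOF-GS2.md RC-4) enter the LINES under the halves (bridge
multiplicativeRankZeroAtTwo_of_muRoad, p409679), not this glue. -/
@[route_item "route-BirchSwinnertonDyer-KolyvaginRankRigidityAtTwo", crux]
def MultPublishedInputsAtTwo : Prop :=
  Literature.NumberTheory.EllipticCurves.rank_eq_analyticRank_of_analyticRank_le_one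

/-- item stmt-BirchSwinnertonDyer-23951 · support · rank 9 · open · by planner
sources: BCDT2001, HoffsteinLuo1997, DokchitserDokchitser2010, Kolyvagin1989, GrossZagier1986, GrossLMS1991
[support] [S2, printed inputs at p = 2, all theorems in print] Modularity
(`ModularForms.exists_isNewformOf`, BCDT 2001) ∧ Hoffstein–Luo non-vanishing of quadratic twists
with prescribed local behaviour (`HoffsteinLuo1997_exists_twist_L_one_ne_zero`) ∧ 2-parity `p_parity
V 2` for every elliptic V/ℚ (Dokchitser–Dokchitser 2010 Thm 1.4 with Monsky) ∧
`kato_finite_of_L_one_ne_zero V 2` (L(V,1) ≠ 0 ⇒ V(ℚ), Ш(V)[2^∞], Sel_(2^∞)(V) finite: Kolyvagin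
1990 Thm A + Gross–Zagier + BFH/MM, p = 2 included since all of Ш is finite) ∧
`hasEntireLFunction_rat` ∧ Gross–Zagier over K in the form ord_(s=1) L(E/K,s) = 1 ↔ y_K non-torsion
(`analyticRankEK_eq_one_iff_heegner_nonTorsion`) ∧ Shimura reciprocity at conductor 1
(`heegnerPointOfConductor_one_galoisConj`). The glue consumes exactly these; none involves p-adic
methods at 2. [difficulty: provable-now] -/
@[route_item "route-BirchSwinnertonDyer-KolyvaginRankRigidityAtTwo", crux]
def PrintedInputsRankOneAtTwo : Prop :=
  Literature.NumberTheory.EllipticCurves.ModularForms.exists_isNewformOf ∧ Literature.NumberTheory.EllipticCurves.HoffsteinLuo1997_exists_twist_L_one_ne_zero ∧ (∀ (V : WeierstrassCurve ℚ) [V.IsElliptic], Literature.NumberTheory.EllipticCurves.p_parity V 2) ∧ (∀ (V : WeierstrassCurve ℚ) [V.IsElliptic], Literature.NumberTheory.EllipticCurves.kato_finite_of_L_one_ne_zero V 2) ∧ WeierstrassCurve.hasEntireLFunction_rat ∧ (∀ (V : WeierstrassCurve ℚ) (N : ℕ) [NeZero N] (K : Type) [Field K] [NumberField K], Literature.NumberTheory.EllipticCurves.analyticRankEK_eq_one_iff_heegner_nonTorsion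 V N K) ∧ (∀ (N : ℕ) [NeZero N] (V : WeierstrassCurve ℚ) (K : Type) [Field K] [NumberField K], Literature.NumberTheory.EllipticCurves.heegnerPointOfConductor_one_galoisConj N V K)

/-- item stmt-BirchSwinnertonDyer-23952 · support · rank 9 · closed · proved by Summit.BirchSwinnertonDyer.BirchSwinnertonDyer.Theorems.KolyvaginRankRigidity.noTwoTorsionOverK_proof (prover) · by planner
sources: Serre1972, SilvermanAEC2009
[support] [S3, (tor) at 2] If ρ̄_(E,2^m) is onto for all m (only m = 1 is used: Gal(ℚ(E[2])/ℚ) ≅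
GL₂(𝔽₂) ≅ S₃) and K is imaginary quadratic then E(K)[2] = 0: the 2-division cubic is irreducible
over ℚ with Galois group S₃, so its roots generate cubic fields, none of which lies in the quadratic
field K. (The tree lemma `torsionBy_eq_bot_of_isImaginaryQuadratic` has the hypothesis p ≠ 2; this
is its p = 2 case, by the S₃ argument instead of the determinant argument.) [difficulty:
provable-now] -/
@[route_item "route-BirchSwinnertonDyer-KolyvaginRankRigidityAtTwo", crux]
def NoTwoTorsionOverK : Prop :=
  ∀ (W : WeierstrassCurve ℚ) [W.IsElliptic], (∀ m : ℕ, W.HasSurjectiveModNGaloisRep (2 ^ m : ℕ)) → ∀ (K : Type) [Field K] [NumberField K], Literature.NumberTheory.EllipticCurves.IsImaginaryQuadratic K → AddSubgroup.torsionBy (W.baseChange K).toAffine.Point (2 : ℤ) = ⊥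

-- `NoTwoTorsionOverK` holds: proved by `Summit.BirchSwinnertonDyer.BirchSwinnertonDyer.Theorems.KolyvaginRankRigidity.noTwoTorsionOverK_proof` (its module imports this route file, so no `_holds` link can be stated here).

/-- item stmt-BirchSwinnertonDyer-25006 · support · rank 9 · open · by planner
sources: BumpFriedbergHoffstein1990, BumpFriedbergHoffstein1989BAMS
[print input, BY NAME — director-bsd 02:13:39Z 'close 24304 (BFH tree fact)']
Bump–Friedberg–Hoffstein 1990 Theorem (i) (S-split, D<0 form): for w(E)=+1 and any finite S, B there
is an imaginary quadratic Heegner field K with |d_K|>B, every q ∈ S split, and L(E^{(d_K)},s) having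
a simple zero at 1 — tree fact bumpFriedbergHoffstein_exists_heegnerField_split_twist_simpleZero. -/
@[route_item "route-BirchSwinnertonDyer-KolyvaginRankRigidityAtTwo", crux]
def BFHTwistSupply : Prop :=
  Literature.NumberTheory.EllipticCurves.bumpFriedbergHoffstein_exists_heegnerField_split_twist_simpleZero

/-- item stmt-BirchSwinnertonDyer-25007 · support · rank 9 · closed · proved by Summit.BirchSwinnertonDyer.BirchSwinnertonDyer.Theorems.simpleZeroTwistSplitAtTwoOfBFH_proof (prover) · by planner
sources: BumpFriedbergHoffstein1990, Cox1989
[provable-now packaging] The route's r=0 supply SimpleZeroTwistSplitAtTwo (24304) is the S={2}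
instance of the BFH tree fact plus the elementary clause «2 split in an imaginary quadratic K ⟹ d_K
≡ 1 (mod 8)» (cf. the tree's converse satisfiesHeegnerHypothesis_two_of_discr_emod_eight). Once
proved, 24304 is discharged by name and leaves the cone (aside). -/
@[route_item "route-BirchSwinnertonDyer-KolyvaginRankRigidityAtTwo", crux]
def SimpleZeroTwistSplitAtTwoOfBFH : Prop :=
  BFHTwistSupply → SimpleZeroTwistSplitAtTwo

-- `SimpleZeroTwistSplitAtTwoOfBFH` holds: proved by `Summit.BirchSwinnertonDyer.BirchSwinnertonDyer.Theorems.simpleZeroTwistSplitAtTwoOfBFH_proof` (its module imports this route file, so no `_holds` link can be stated here).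

/-- item stmt-BirchSwinnertonDyer-23953 · assembly · rank 1 · closed · proved by Summit.BirchSwinnertonDyer.BirchSwinnertonDyer.Theorems.KolyvaginRankRigidity.assembly_proof (prover) · by planner
sources: arXiv:2312.09301, Kolyvagin1991MathAnn, GrossZagier1986, DokchitserDokchitser2010
[assembly] KolyvaginNonvanishingAtTwo → KolyvaginCorankRigidityAtTwo → OffHabitatTwoConverse →
PrintedInputsRankOneAtTwo → NoTwoTorsionOverK → Rank1Residual.NonCMTwoConverse (the S3 leaf;
`closes_target`). -/
@[route_item "route-BirchSwinnertonDyer-KolyvaginRankRigidityAtTwo"]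
def Assembly : Prop :=
  KolyvaginNonvanishingAtTwo → KolyvaginCorankRigidityAtTwo → OffHabitatTwoConverse → PrintedInputsRankOneAtTwo → NoTwoTorsionOverK → Summit.BirchSwinnertonDyer.BirchSwinnertonDyer.Rank1Residual.NonCMTwoConverse

-- `Assembly` holds: proved by `Summit.BirchSwinnertonDyer.BirchSwinnertonDyer.Theorems.KolyvaginRankRigidity.assembly_proof` (its module imports this route file, so no `_holds` link can be stated here).

/-! D-0027 §2.1 — DECIDING THEOREM (planner-authored via `route open/edit --closes-file`; by planner-bsd-idea-1-g7-0 2026-08-28T13:54:03Z):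
its hypotheses are this route's items and its conclusion the registered leaf `Summit.BirchSwinnertonDyer.BirchSwinnertonDyer.Rank1Residual.NonCMTwoConverse` (rung S3, D-0061) (glue_lint), and it elaborates with this file. -/

/-- **The deciding theorem (R4-∞: the rich pair V1′∞ / V2♭∞, method-proof form)** — the route's `closes` VERBATIM except that V1′∞
supplies a rich depth, the least rich depth is taken (`Nat.find`), and V2♭∞ forces it to be `0`. It
concludes the registered leaf `Rank1Residual.NonCMTwoConverse`.
[cite: Kolyvagin1991MathAnn, §2] [cite: GrossZagier1986, I (6.1)] -/
@[closes "route-BirchSwinnertonDyer-KolyvaginRankRigidityAtTwo"] theorem closes (hV1 : KolyvaginStrongNonzeroSystemAtTwo)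
    (hV2 : KolyvaginCorankLowerBoundAtTwoRich)
    (hR : OffHabitatNonSurjTwoConverse) (hIn : PrintedInputsRankOneAtTwo) (hT : NoTwoTorsionOverK)
    (hf : BFHTwistSupply) (h0 : SimpleZeroTwistSplitAtTwoOfBFH) (hGZK : MultPublishedInputsAtTwo)
    (hMod : NewformOfEllipticCurve) (hHLT : HoffsteinLuoNonvanishingTwist) (hEnt : EntireLFunctionRat) :
    Summit.BirchSwinnertonDyer.BirchSwinnertonDyer.Rank1Residual.NonCMTwoConverse := by
  have hBFH : SimpleZeroTwistSplitAtTwo := h0 hf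
  intro W _ _ hCM hred r hr hc
  by_cases hsur : (∀ m : ℕ, W.HasSurjectiveModNGaloisRep (2 ^ m : ℕ))
  swap
  · exact hR W hCM hred r hr hc hsur
  obtain ⟨-, -, hpar, hKato, -, hGZ, hrec⟩ := hIn
  have hmod : Literature.NumberTheory.EllipticCurves.ModularForms.exists_isNewformOf := hMod
  have hHL : Literature.NumberTheory.EllipticCurves.HoffsteinLuo1997_exists_twist_L_one_ne_zero := hHLT
  have hE : WeierstrassCurve.hasEntireLFunction_rat := hEnt
  have hGZK' : Literature.NumberTheory.EllipticCurves.rank_eq_analyticRank_of_analyticRank_le_one := hGZK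
  haveI : Fact (Nat.Prime 2) := ⟨Nat.prime_two⟩
  haveI : NeZero (W.conductorNorm ℤ) := ⟨(W.conductorNorm_pos_holds).ne'⟩
  obtain rfl | rfl : r = 0 ∨ r = 1 := by omega
  · -- ===== r = 0 : partner twist with a simple zero (BFH 1990 (i), `2` split) =====
    have hw : W.rootNumber = 1 := by
      have h := hpar W
      unfold Literature.NumberTheory.EllipticCurves.p_parity at h
      rw [hc, pow_zero] at h
      exact h.symm
    obtain ⟨K, _, _, hK, -, hHN, hH2, hd8, hL0, hL1⟩ := hBFH W hw 0
    have hodd : Odd (NumberField.discr K) := by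
      rw [Int.odd_iff]; omega
    have hne3 : NumberField.discr K ≠ -3 := by omega
    have hne4 : NumberField.discr K ≠ -4 := by omega
    have h2d : ¬ ((2 : ℤ) ∣ NumberField.discr K) := by omega
    have hd : (NumberField.discr K : ℚ) ≠ 0 := by exact_mod_cast NumberField.discr_ne_zero K
    haveI := W.isElliptic_quadraticTwist hd
    have hr1 : (W.quadraticTwist (NumberField.discr K : ℚ)).analyticRank = 1 :=
      Literature.NumberTheory.EllipticCurves.analyticRank_eq_one_of_entireLFunction_one_eq_zero_of_deriv_ne_zero
        _ (hE _) hL0 hL1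
    obtain ⟨hrk, hsha⟩ := hGZK' (W.quadraticTwist (NumberField.discr K : ℚ)) (le_of_eq hr1)
    rw [hr1] at hrk
    haveI := hsha
    have hc' : (W.quadraticTwist (NumberField.discr K : ℚ)).selmerCorank 2 = 1 :=
      Literature.NumberTheory.EllipticCurves.selmerCorank_eq_one_of_mordellWeilRank_eq_one_of_finite
        (W.quadraticTwist (NumberField.discr K : ℚ)) 2 hrk inferInstance
    have htor := hT W hsur K hK
    obtain ⟨fW, hfW⟩ := hMod W
    obtain ⟨Dt⟩ :=
      Literature.NumberTheory.Automorphic.nonempty_modularParametrizationData_of_isNewformOf hfW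
    obtain ⟨β, hβ⟩ := Literature.NumberTheory.EllipticCurves.exists_dvd_sq_sub_discr_holds (W.conductorNorm ℤ) K hK hHN
    obtain ⟨ι⟩ := (inferInstance : Nonempty (K →+* ℂ))
    obtain ⟨r, hr⟩ := hV1 W hCM hred hsur K hK hHN hodd hne3 htor hH2 Dt β ι hβ
    -- the least RICH depth `ν ≤ r`
    have hex : ∃ ν : ℕ, ∀ θ k : ℕ, ∃ (n : ℕ)
        (d : Literature.NumberTheory.EllipticCurves.KolyvaginHeegnerData Dt β ι n) (M : ℕ),
        Literature.NumberTheory.EllipticCurves.KolyvaginDescent.KolSupp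
          (Literature.NumberTheory.EllipticCurves.Zhang2014.IsKolyvaginPrime (W.conductorNorm ℤ) W K 2) n ∧
        n.primeFactors.card = ν ∧ 1 ≤ M ∧
        ((θ * M + k : ℕ) : ℕ∞) ≤ Literature.NumberTheory.EllipticCurves.Zhang2014.levelIndex W 2 n ∧
        d.kolyvaginClass Nat.prime_two M ≠ 0 := ⟨r, hr⟩
    have hrich := Nat.find_spec hex
    have hbelow : ∀ ν' : ℕ, ν' < Nat.find hex → ∃ θ k : ℕ, ∀ (n' : ℕ)
        (d' : Literature.NumberTheory.EllipticCurves.KolyvaginHeegnerData Dt β ι n') (M' : ℕ),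
        Literature.NumberTheory.EllipticCurves.KolyvaginDescent.KolSupp
          (Literature.NumberTheory.EllipticCurves.Zhang2014.IsKolyvaginPrime (W.conductorNorm ℤ) W K 2) n' →
        1 ≤ M' →
        ((θ * M' + k : ℕ) : ℕ∞) ≤ Literature.NumberTheory.EllipticCurves.Zhang2014.levelIndex W 2 n' →
        n'.primeFactors.card = ν' → d'.kolyvaginClass Nat.prime_two M' = 0 := by
      intro ν' hν'
      have h := Nat.find_min hex hν'
      rw [not_forall] at h
      obtain ⟨θ, h⟩ := h
      rw [not_forall] at h
      obtain ⟨k, hθk⟩ := h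
      exact ⟨θ, k, fun n' d' M' hn' hM' hle hcard ↦ by
        by_contra hne'; exact hθk ⟨n', d', M', hn', hcard, hM', hle, hne'⟩⟩
    -- the ONLY use of V2: the lower bound `ν + 1 ≤ max(c, c') = 1` forces `ν = 0`
    have hstruct := hV2 W hCM hred hsur K hK hne3 hne4 h2d hHN Dt β ι (Nat.find hex) hrich hbelow
    have hν : Nat.find hex = 0 := by
      rcases hstruct with h1 | h1 <;> omega
    rw [hν] at hrich
    obtain ⟨n₀, d₀, M₀, hn₀, hν0, hM₀, -, hne₀⟩ := hrich 0 0
    have hn1 : n₀ = 1 := by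
      rw [Finset.card_eq_zero, Nat.primeFactors_eq_empty] at hν0
      rcases hν0 with h0 | h1
      · exact absurd (h0 ▸ hn₀.1) not_squarefree_zero
      · exact h1
    subst hn1
    have hEK : Literature.NumberTheory.EllipticCurves.analyticRankEK W K = 1 :=
      Literature.NumberTheory.EllipticCurves.heegnerSystem_analyticRankEK_eq_one_of_kolyvaginClass_one_ne_zero
        (hGZ W _ K) (hrec _ W K) hK rfl hHN d₀ hne₀
    rw [Literature.NumberTheory.EllipticCurves.analyticRankEK_eq_add_of hE W K, hr1] at hEK
    omega
  · -- ===== r = 1 : partner twist with L(E^{(d_K)}, 1) ≠ 0 (Hoffstein–Luo) =====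
    have hw : W.rootNumber = -1 := by
      have h := hpar W
      unfold Literature.NumberTheory.EllipticCurves.p_parity at h
      rw [hc, pow_one] at h
      exact h.symm
    obtain ⟨K, _, _, hK, -, hHN, hH2, hd8, hL1⟩ :=
      Literature.NumberTheory.EllipticCurves.exists_heegnerField_split_twist_ne_zero_discr_emod_eight_of_hoffsteinLuo
        hmod hHL W hw Nat.prime_two 0
    have hodd : Odd (NumberField.discr K) := by
      rw [Int.odd_iff]; omega
    have hne3 : NumberField.discr K ≠ -3 := by omega
    have hne4 : NumberField.discr K ≠ -4 := by omega
    have h2d : ¬ ((2 : ℤ) ∣ NumberField.discr K) := by omega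
    have hd : (NumberField.discr K : ℚ) ≠ 0 := by exact_mod_cast NumberField.discr_ne_zero K
    haveI := W.isElliptic_quadraticTwist hd
    obtain ⟨-, -, hfin⟩ := hKato (W.quadraticTwist (NumberField.discr K : ℚ)) hL1
    haveI := hfin
    have hc' : (W.quadraticTwist (NumberField.discr K : ℚ)).selmerCorank 2 = 0 :=
      (W.quadraticTwist (NumberField.discr K : ℚ)).selmerCorank_eq_zero_of_finite 2
    have htor := hT W hsur K hK
    obtain ⟨fW, hfW⟩ := hMod W
    obtain ⟨Dt⟩ :=
      Literature.NumberTheory.Automorphic.nonempty_modularParametrizationData_of_isNewformOf hfW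
    obtain ⟨β, hβ⟩ := Literature.NumberTheory.EllipticCurves.exists_dvd_sq_sub_discr_holds (W.conductorNorm ℤ) K hK hHN
    obtain ⟨ι⟩ := (inferInstance : Nonempty (K →+* ℂ))
    obtain ⟨r, hr⟩ := hV1 W hCM hred hsur K hK hHN hodd hne3 htor hH2 Dt β ι hβ
    -- the least RICH depth `ν ≤ r`
    have hex : ∃ ν : ℕ, ∀ θ k : ℕ, ∃ (n : ℕ)
        (d : Literature.NumberTheory.EllipticCurves.KolyvaginHeegnerData Dt β ι n) (M : ℕ),
        Literature.NumberTheory.EllipticCurves.KolyvaginDescent.KolSupp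
          (Literature.NumberTheory.EllipticCurves.Zhang2014.IsKolyvaginPrime (W.conductorNorm ℤ) W K 2) n ∧
        n.primeFactors.card = ν ∧ 1 ≤ M ∧
        ((θ * M + k : ℕ) : ℕ∞) ≤ Literature.NumberTheory.EllipticCurves.Zhang2014.levelIndex W 2 n ∧
        d.kolyvaginClass Nat.prime_two M ≠ 0 := ⟨r, hr⟩
    have hrich := Nat.find_spec hex
    have hbelow : ∀ ν' : ℕ, ν' < Nat.find hex → ∃ θ k : ℕ, ∀ (n' : ℕ)
        (d' : Literature.NumberTheory.EllipticCurves.KolyvaginHeegnerData Dt β ι n') (M' : ℕ),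
        Literature.NumberTheory.EllipticCurves.KolyvaginDescent.KolSupp
          (Literature.NumberTheory.EllipticCurves.Zhang2014.IsKolyvaginPrime (W.conductorNorm ℤ) W K 2) n' →
        1 ≤ M' →
        ((θ * M' + k : ℕ) : ℕ∞) ≤ Literature.NumberTheory.EllipticCurves.Zhang2014.levelIndex W 2 n' →
        n'.primeFactors.card = ν' → d'.kolyvaginClass Nat.prime_two M' = 0 := by
      intro ν' hν'
      have h := Nat.find_min hex hν'
      rw [not_forall] at h
      obtain ⟨θ, h⟩ := h
      rw [not_forall] at h
      obtain ⟨k, hθk⟩ := h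
      exact ⟨θ, k, fun n' d' M' hn' hM' hle hcard ↦ by
        by_contra hne'; exact hθk ⟨n', d', M', hn', hcard, hM', hle, hne'⟩⟩
    -- the ONLY use of V2: the lower bound `ν + 1 ≤ max(c, c') = 1` forces `ν = 0`
    have hstruct := hV2 W hCM hred hsur K hK hne3 hne4 h2d hHN Dt β ι (Nat.find hex) hrich hbelow
    have hν : Nat.find hex = 0 := by
      rcases hstruct with h1 | h1 <;> omega
    rw [hν] at hrich
    obtain ⟨n₀, d₀, M₀, hn₀, hν0, hM₀, -, hne₀⟩ := hrich 0 0
    have hn1 : n₀ = 1 := by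
      rw [Finset.card_eq_zero, Nat.primeFactors_eq_empty] at hν0
      rcases hν0 with h0 | h1
      · exact absurd (h0 ▸ hn₀.1) not_squarefree_zero
      · exact h1
    subst hn1
    have hEK : Literature.NumberTheory.EllipticCurves.analyticRankEK W K = 1 :=
      Literature.NumberTheory.EllipticCurves.heegnerSystem_analyticRankEK_eq_one_of_kolyvaginClass_one_ne_zero
        (hGZ W _ K) (hrec _ W K) hK rfl hHN d₀ hne₀
    rw [Literature.NumberTheory.EllipticCurves.analyticRankEK_eq_add_of hE W K,
      Literature.NumberTheory.EllipticCurves.analyticRank_eq_zero_of_entireLFunction_one_ne_zero _ hL1,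
      add_zero] at hEK
    exact hEK

end Summit.BirchSwinnertonDyer.BirchSwinnertonDyer.Theses.KolyvaginRankRigidityAtTwo
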